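import Mathlib
import HarnessLib
import HarnessLib.Audit
import Summits.BirchSwinnertonDyer.Statement
import Summits.BirchSwinnertonDyer.Rank1Residual.ManinConstantOne
import Summits.BirchSwinnertonDyer.BirchSwinnertonDyer.Theorems.TeichmullerTwistDescentCellsOfKatoIhara
import Summits.BirchSwinnertonDyer.BirchSwinnertonDyer.Theorems.ManinLocalTwoThreeAssembly
import Literature.NumberTheory.EllipticCurves.ManinConstantQuadraticTwistTransportProofs
import Literature.NumberTheory.EllipticCurves.ManinConstantQuadraticTwistIstarProofs
import Literature.NumberTheory.EllipticCurves.ManinConstantConductorLe300000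
import Literature.NumberTheory.EllipticCurves.ManinConstantConductorLt500000
import Literature.NumberTheory.EllipticCurves.KenkuMinimalLevels
import Literature.NumberTheory.EllipticCurves.PrimeDegreeIsogenyJTable
import Literature.NumberTheory.EllipticCurves.ModularCurveIharaLemmaSquare
import Literature.NumberTheory.EllipticCurves.IsogenyNeronScalarPotSupersingular
import Literature.NumberTheory.DiophantineGeometry.FaltingsHeight
import Summits.BirchSwinnertonDyer.BirchSwinnertonDyer.Theorems.ManinLocalTwoThreeManinOddAtFourCdtThm1
import Summits.BirchSwinnertonDyer.BirchSwinnertonDyer.Theorems.ManinLocalTwoThreeManinPrimeToThreeAtNineCdtThm1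
import Summits.BirchSwinnertonDyer.BirchSwinnertonDyer.Theorems.ManinLocalTwoThreeManinPrimeToAdditiveFiveLeCdtThm1
import HarnessLib.Audit.Status.Attr

/-!
Route: TwistFamilyManinDescent

# Route TwistFamilyManinDescent — Manin's conjecture along quadratic-twist families — X5 reduced to
Eisenstein p in 5,7,13

LINE 10 of ideator seat bsd-idea-3 (D-0145; technique card «finite-model / certified-instrument
design»; bears_on rung F2-MANIN =
`ManinConstantOne`, via f2-manin's residual crux X₅ `ManinPrimeToAdditiveFiveLe` (stmt-22969), of
which this route is an
ALTERNATIVE DECOMPOSITION sharing X₂/X₃/PF/X₅ with route ManinLocalTwoThree). It suffices to show: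
(K1) Manin's |c| = 1 is
inherited by the WHOLE quadratic-twist family E₀ ⊗ d from the two inner twists E₀ ⊗ (±d₀) (d₀ = the
part of d on 2·A,
A ⊇ odd additive primes of E₀) — the iterated Γ₀ twist step; (K2) hence |c| = 1 for EVERY curve
whose j lies in the
prime-degree isogeny table (ℓ = 11, 17, 19, 37, 43, 67; and 163 off the 2⁶-corner) — infinitely many
classes of unbounded
conductor, from eleven certified base classes of conductor ≤ 462400 < 5·10⁵ (Cremona); (R) the
declared RESIDUAL: p ∤ c for the
Eisenstein (E[p] reducible) additive TWIST-MINIMAL rows at p ∈ {5, 7, 13} (+ the 2⁶-corner of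
j(−163)). With the Kato road
(E[p] irreducible, tree, mod F″ + Ihara³), Mazur's j-table and the tree's I*-descent these give X₅;
X₂, X₃ stay shared open cruxes.
No summit, rung or crux is proved by filing this line.
Lean: `KatoIharaCremonaFacts → TwistFamilyDescent → IsogenyTableFamiliesManinOne →
LargePrimeReducibleJ → IrreducibleAdditiveManinUnit → EisensteinAdditiveManinResidual →
ManinPrimeToAdditiveFiveLe`

CLOSES_TARGET: closes rung F2-MANIN of BirchSwinnertonDyer: Summit.BirchSwinnertonDyer.Rank1Residual.ManinConstant.ManinConstantOne (D-0061; not the summit Statement) — the deciding theorem of this route concludes that registered leaf instead of the Statement decl `BirchSwinnertonDyer` (class rung: servable and labelled, never counted as concluding the summit Statement).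

Rationale: WHY THIS LINE. The tree already holds the ONE-STEP semistable-prime descent of the class
certificate, `classAbsManinConstantEqOne_of_quadraticTwist_pStar`
(Stevens1989 Lemmas (5.2), (5.4) on Γ₀ = `maninConstant_dvd_of_charTwist_gamma0`; binder
`exists_isNewformOf` only, NO level bound), and
Cremona's determined range `cremona_abs_maninConstant_eq_one_of_level_le_500000`
(CremonaAlgorithms1997, AgasheRibetStein2006 Thm. 2.6
extended). Iterating the step over every odd prime of d outside 2A lands in a FINITE set of inner
twists, so Manin's conjecture becomes a
FAMILY property decided by a finite certified base — the finite-model lens. Fed with Mazur1978 Thm.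
1 + Kenku1982 (the tree's
`largePrimeIsogenyJTable`: reducible E[p], p ≥ 11, p ≠ 13 ⇒ eleven j's) it makes the p ∈ {11, 17}
REDUCIBLE additive rows R₁₁,₁₇ —
which f2-manin's X₅ docstring leaves to Edixhoven's unpublished thesis Thm. 4.6.3 (acq-13486)
because the printed §4 chain flips
121c1 ↔ 121a2 — THEOREMS from tree facts, together with the CM families −11, −19, −43, −67 and the
−7·11³ pair. Imported from:
modular symbols (Stevens), Diophantine finiteness of X₀(ℓ)(ℚ) (Mazur–Kenku), certified tables
(Cremona); the Kato road
(Kato2004Asterisque + DiamondRibet1997, tree theorem `not_dvd_c_of_kato_of_iharaSq_of_witness` with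
the Chebotarev witness
DISCHARGED) covers E[p] irreducible. No listed route decomposes X₅; EF57/TTD/TQMP (mine) carry `Irr`
and sit on the W-ALL rung.

RANKED CRUXES. #2 TwistFamilyDescent (crux) — WHOLE-FAMILY DESCENT. Given modularity: for E₀/ℚ
elliptic and A ∈ ℕ divisible by every odd additive prime of E₀, for d₀, d₁ ≠ 0 with d₁ coprime to
2·A·d₀: if the classes of E₀ ⊗ d₀ and E₀ ⊗ (−d₀) satisfy the class Manin certificate (|c| = 1 for
every lattice-optimal X₀-datum of every globally minimal member), so does the class of E₀ ⊗ (d₀d₁).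
Proof plan: reduce d₁ to squarefree (variable change ⇒ isogenous,
`ClassAbsManinConstantEqOne.of_isIsogenous`); induct on the odd primes q ∣ d₁: E₀ semistable at q (q
∤ A), W = E₀ ⊗ d₀d₁ additive at q with q² ∣ N(W), W ⊗ q* ≅ E₀ ⊗ (d₀d₁/q · ±1) semistable at q
(`hasReductionAt_quadraticTwist_iff_of_not_dvd`, `quadraticTwist_quadraticTwist`,
`exists_variableChange_quadraticTwist_mul_sq`), one step =
`classAbsManinConstantEqOne_of_quadraticTwist_pStar`; the sign lands on ±d₀. [difficulty: M] (why it
might fail: the step needs f_W exactly the χ_{q*}-twist of the partner's newform and q² ∣ N(W); at q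
= 3 ∣ d₁ with E₀ semistable at 3 the twist is tame (f₃ = 2) so it holds — a failure would be a
conductor-exponent slip at q = 3, not at q ≥ 5.) [Stevens1989, AgasheRibetStein2006,
EdixhovenManin1991, SilvermanAEC2009]
#3 IsogenyTableFamiliesManinOne (crux) — THE ISOGENY-TABLE FAMILIES (beyond print; infinitely many
classes of unbounded conductor). Given modularity and Cremona's |c| = 1 for N ≤ 500000: every
elliptic W/ℚ with j ∈ {−2¹⁵, −11², −11·131³, −17²·101³/2, −17·373³/2¹⁷, −96³, −7·11³, −7·137³·2083³,
−960³, −5280³}, or with j = −640320³ and 2⁶ ∤ N(W), satisfies the class Manin certificate. Plan: W ≅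
E₀ ⊗ d for the base model E₀ of that j (`exists_variableChange_eq_quadraticTwist_of_j_eq`, j ≠ 0,
1728); TwistFamilyDescent with A = rad of the odd additive primes of E₀ (11 | 5·17 | 19 | 5·7 | 43 |
67 | 163); the ≤ 16 inner twists E₀ ⊗ (±d₀), d₀ ∣ 2·A squarefree, have conductor ≤ 2⁶·5²·17² =
462400 (BarriosEtAl2025 dyadic exponents `conductorExponent_quadraticTwist_of_hasGoodReductionAt` /
`…_two_of_le_one_holds`, f_p ≤ 2 for p ≥ 5) hence |c| = 1 by
`classAbsManinConstantEqOne_of_conductorNorm_le_500000`; for −640320³ only odd d₀ (2⁶ ∤ N): 26569,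
425104. [deps: TwistFamilyDescent] [difficulty: L] (why it might fail: an inner twist outside
Cremona's range: the instrument row is the conductor of 14450 ⊗ (±2·5·17) = 2⁶·5²·17² = 462400 <
5·10⁵ (tightest); j(−163) ⊗ χ±8 has 2⁶·163² = 1700416 > 5·10⁵ and is EXCLUDED (sent to the residual
corner).) [CremonaAlgorithms1997, AgasheRibetStein2006, Kenku1982, Mazur1978, arXiv:2409.16248]
#4 EisensteinAdditiveManinResidual (crux) — DECLARED RESIDUAL (the honest open core of X₅ after this
line; not attacked here). Given the printed semistable facts and modularity: for W globally minimal
with a lattice-optimal X₀(N)-datum, p ∈ {5, 7, 13} — or p = 163 with 2⁶ ∣ N — with p² ∣ N, E[p]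
REDUCIBLE and W ⊗ χ_{p*} NOT semistable at p (twist-minimal additive: potentially good, e_p ∈ {3, 4,
6}), p ∤ c. These are the rational-p-isogeny curves of genus-0 level (X₀(5), X₀(7), X₀(13):
infinitely many j) at their additive twist-minimal fibres, where Raynaud e < p − 1 and the Kato road
(needs Irr) are both void. [difficulty: open-problem] (why it might fail: it is Manin's conjecture
at an Eisenstein additive prime p ∈ {5,7,13}: one optimal curve with 25 ∣ N, a rational 5-isogeny, W
⊗ χ₅ additive and 5 ∣ c beyond N = 500000 refutes it; no printed method reaches e_p ≥ 3 with E[p]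
reducible.) [EdixhovenManin1991, arXiv:1705.09251, CesnaviciusNeururerSaha2023, Mazur1978]
#5 ManinOddAtFour (crux) — SHARED with route ManinLocalTwoThree (stmt-BirchSwinnertonDyer-22967,
verbatim): Manin's conjecture at the prime 2 for 4 ∣ N, given the printed semistable facts and
modularity. Not attacked by this line. [difficulty: open-problem] (why it might fail: a class with 4
∣ N, Γ₁-constant 1 but c₀ = 2 (ČNS Lemma 6.5 allows c₀/c₁ ∈ {1,2}; Stevens' η = 2 exists) refutes
it; twist-minimal classes v₂(N) ∈ {5,…,8} have no semistable partner.) [Cesnavicius2018,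
CesnaviciusNeururerSaha2023, Stevens1989]
#6 ManinPrimeToThreeAtNine (crux) — SHARED with route ManinLocalTwoThree
(stmt-BirchSwinnertonDyer-22968, verbatim): Manin's conjecture at the prime 3 for 9 ∣ N, given the
printed semistable facts and modularity. Not attacked by this line. [difficulty: open-problem] (why
it might fail: twist-minimal classes at 3 (27 ∣ N) have no transport partner; ČNS give only v₃(c) ≤
v₃(deg φ) and 3 ∣ deg φ is forced on whole families; Raynaud e < p − 1 fails at p = 3.)
[CesnaviciusNeururerSaha2023, EdixhovenManin1991, Stevens1989]
#9 LargePrimeReducibleJ (support) — KNOWN (Mazur 1978 Thm. 1 + Ligozat 1975 / Mazur–Swinnerton-Dyer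
1974 / Kenku 1982: the rational points of X₀(ℓ), ℓ ∈ {11,17,19,37,43,67,163}; Cremona 1997 §3.8 p.
82): an elliptic W/ℚ with E[p] reducible for a prime p ≥ 11, p ≠ 13 has (p, j(W)) in the tree's
`largePrimeIsogenyJTable`. From the named facts `mazur_isogeny_irreducible` +
`primeDegreeIsogeny_jTable` + (reducible ⇒ rational p-isogeny). [difficulty: M] [Mazur1978,
Kenku1982, CremonaAlgorithms1997]
#9 IrreducibleAdditiveManinUnit (support) — PROVABLE NOW (one line, `Sketch10.lean`
`irreducibleAdditiveManinUnit_holds`): given modularity, F″ (Kato–Néron integrality) and Ihara³, for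
W globally minimal additive at p ≥ 5 with E[p] irreducible and D lattice-optimal at any level, p ∤ c
— `TeichmullerTwistDescent.not_dvd_c_of_kato_of_iharaSq_of_witness` with the discharged Chebotarev
witness `NonEisensteinWitness.lTwistWitness`. [difficulty: provable-now] [Kato2004Asterisque,
DiamondRibet1997, KostersPannekoek2017]
#9 ManinPrimeToAdditiveFiveLe (support) — SHARED X₅ of route ManinLocalTwoThree
(stmt-BirchSwinnertonDyer-22969, verbatim; their declared residual): p ≥ 5, p² ∣ N ⇒ p ∤ c given the
printed facts and modularity. In THIS route it is the conclusion of the item Assembly, i.e. provable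
from the items above plus the residual. [difficulty: open-problem] [EdixhovenManin1991,
CesnaviciusNeururerSaha2023]
#9 PrintedSemistableManinFacts (support) — SHARED hypothesis bundle of route ManinLocalTwoThree
(stmt-BirchSwinnertonDyer-22970, verbatim): Mazur 1978 Cor. 4.1 ∧ Abbes–Ullmo 1996 Thm. A ∧
Česnavičius 2018 Thm. 1.2 ∧ the Modularity Theorem, as named Literature facts consumed as
hypotheses. [difficulty: S] [Mazur1978, AbbesUllmo1996, Cesnavicius2018, DiamondShurman2005]
#9 KatoIharaCremonaFacts (support) — Hypothesis bundle (cite-only Literature facts displayed, never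
asserted): F″ = Kato–Néron integrality of twisted modular-symbol sums at additive p ≥ 5 ∧ Ihara³
(Diamond–Ribet 1997 Lemma 4.6) ∧ Cremona's |c| = 1 for every lattice-optimal X₀(N)-datum with N ≤
500000. [difficulty: S] [Kato2004Asterisque, DiamondRibet1997, CremonaAlgorithms1997,
AgasheRibetStein2006]

TWO-LAYER PLAN. IsogenyTableFamiliesManinOne ⇐ (BaseConductorCertificate: the ≤ 16 inner twists of
each of the 8 base models have conductor ≤ 500000)
→ (JToTwist: W.j = j(E₀) ⇒ W ≅ E₀ ⊗ d, Silverman X.5.4) → IsogenyTableFamiliesManinOne, k = 2, once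
TwistFamilyDescent closes.
EisensteinAdditiveManinResidual ⇐ split by p (5 | 7 | 13) only if a lever appears; not now.

KILL CRITERIA. A lattice-optimal X₀(N)-datum with |c| ≠ 1 in one of the eleven j-families (refutes
IsogenyTableFamiliesManinOne and Manin's conjecture
itself) closes the route `refuted:IsogenyTableFamiliesManinOne`. A refutation of TwistFamilyDescent
(a conductor-exponent slip at q = 3)
forces the pivot "d₁ coprime to 6·A·d₀" (restate). If f2-manin closes X₅ outright, this route is
superseded (`--reason superseded --by
route-BirchSwinnertonDyer-ManinLocalTwoThree`). The residual refuted ⇒ Manin's conjecture is false;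
every Manin route dies with it.

NOT DECOMPOSED YET. The base-conductor certificate (eight explicit models, dyadic exponents via
BarriosEtAl2025) and the j ⇒ twist step are layer-2
children of IsogenyTableFamiliesManinOne; the reducible ⇒ isogeny bridge inside
LargePrimeReducibleJ; the p-by-p split of the residual.
None is filed now (D-0019: depth is earned after TwistFamilyDescent closes).

CHEAPEST FALSIFIER. LOOKUP (run by me, by hand from Cremona/LMFDB conductor arithmetic, 2026-08-28):
the largest inner-twist conductor over the eleven
families off the −163 dyadic corner is 2⁶·5²·17² = 462400 (class 14450 ⊗ ±2·…), below 500000 — PASS;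
the −163 ⊗ χ±8 corner
(2⁶·163² = 1700416) FAILS the range and is therefore excluded from the crux and parked in the
residual. Instrument row that would
refute the key lemma: any optimal curve of conductor 121·m², 14450·m²/…, 361·m², 1225·m², 1849·m²,
4489·m² (m coprime to the
level) with c ≠ 1 in Cremona's extended tables (none is known: c = 1 throughout N ≤ 500000).

NUMBERS. Base classes and A: j = −2¹⁵ (121b, A = 11); −11², −11·131³ (121c/121a, A = 11);
−17²·101³/2, −17·373³/2¹⁷ (14450, A = 85,
multiplicative at 2 so f₂ ≤ 6 under χ₋₄/χ±8); −96³ (361a, A = 19); −7·11³, −7·137³·2083³ (1225h, A =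
35); −960³ (1849a, A = 43);
−5280³ (4489a, A = 67); −640320³ (26569a, A = 163, odd d₀ only: 26569, 2⁴·26569 = 425104). Bound
used: f_p ≤ 2 (p ≥ 5), f₂ ≤ 6 for
twists of a curve with f₂ ≤ 1 (BarriosEtAl2025), Cremona range N ≤ 500000. bc5 (witness of
weakness): the one-prime case d₁ = q* of
TwistFamilyDescent is the landed theorem `classAbsManinConstantEqOne_of_quadraticTwist_pStar` (no
level bound — outside Cremona's
range, where ManinConstantOne is open). bc7: 5/5 CLEAN (probe10.txt; TwistFamilyDescent and
IsogenyTableFamiliesManinOne carry the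
informational S→C flag: consequences of Manin used toward it). bc9: method_family = Stevens Γ₀ twist
transport + certified finite base;
ladder_ceiling = capped-at-twist-minimal-additive-Eisenstein (p ∈ {5,7,13}); ceiling_lift = declared
crux EisensteinAdditiveManinResidual;
ceiling_sources = [Theorems/ManinLocalTwoThreeManinPrimeToAdditiveFiveLeGloballyTwistMinimal.lean,
EdixhovenManin1991 §4, arXiv:1705.09251 Thm. 10.1].

DEFINITION REQUESTS. None. Cite facts already named in the tree: `primeDegreeIsogeny_jTable`,
`mazur_isogeny_irreducible`, `cremona_abs_maninConstant_eq_one_of_level_le_500000`,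
`kato_neron_isIntegral_twistedSymbolSum_of_additive_five_le`, `diamondRibet1997_iharaLemma_sq`.

Novelty: Searches (2026-08-28): lit search --hybrid "Manin constant quadratic twist optimal curve conductor
coprime" (8 docs: Cornell–Silverman–Stevens 1997 pp. 580ff, Cremona 1997 p. 94, CES 2003 — no
twist-inheritance statement); lit vsearch "<Manin constant of optimal curve in twisted class equals
original>" (8 docs, none on point); lit search "Manin constant twist" --source all (local 12 +
zbMATH/Crossref 20: arXiv:2102.04185 Esparza-Lozano–Pasten 2021 uses c_E only via integrality;
arXiv:2605.25917 §6 computes Manin–Stevens constants of the sextic family E_{p^{2i}} over K — a CM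
cube-sum setting, not X₀-optimal twist inheritance); lit galaxy search "Manin constant" --star all
(18 rows; Pal 2012 with Agashe's appendix = periods of twists, Conjecture 5.3 on |E(ℚ)|², not c);
tree: rg over Theorems/ManinLocalTwoThree* (f2-manin's
`…ManinPrimeToAdditiveFiveLeGloballyTwistMinimal` records X₅ ⟸ twist-minimal classes prime-wise but
stops there).
Nearest prior art found: Stevens1989 §5 (the one-step lattice comparison, in tree);
AgasheRibetStein2006 Thm. 2.6–2.7 (c = 1 in Cremona's range; semistable primes); f2-manin's
GloballyTwistMinimal reduction (tree, 2026-08-27); Edixhoven's thesis Thm. 4.6.3 (unpublished,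
acq-13486) for R₁₁,₁₇.
Delta: nobody combines the iterated Γ₀ twist descent with the FINITENESS of X₀(ℓ)(ℚ) (ℓ ≥ 11) and
Cremona's certified range to make Manin's conjecture a theorem on the eleven isogeny-table families
(all conductors), removing the reducible p ≥ 11 rows — incl.  [refs: 2102.04185, 2605.25917, Stevens1989, AgasheRibetStein2006]

Barriers (technique_class: twist-lattice-transport, certified-base, j-table): - technique_class: twist-lattice-transport, certified-base, j-table
- Literature.Barriers.BirchSwinnertonDyer.EulerSystemBigImageBarrier: outside for the two family
cruxes and the residual (no Euler system); the support IrreducibleAdditiveManinUnit imports Kato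
only under `Irr` (big image), exactly where the barrier does not bite — the REDUCIBLE rows are
handled by finiteness of X₀(ℓ)(ℚ) + certified tables instead, which is the point of the line.
- Literature.Barriers.BirchSwinnertonDyer.EisensteinMuBarrier: outside — no Iwasawa μ-invariant or
main conjecture is used; the Eisenstein rows at p ≥ 11 are decided by a finite certificate, and the
Eisenstein rows at p ∈ {5,7,13} are the DECLARED residual (not attacked).
- Literature.Barriers.BirchSwinnertonDyer.ReducibleAnticyclotomicAtBadP: outside — no anticyclotomic
/ Heegner input; the reducible-at-bad-p rows are exactly what the j-table finiteness removes for p ≥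
11.
- Literature.Barriers.BirchSwinnertonDyer.AdditiveIwasawaTheoryAtTwoBarrier: not engaged — the prime
2 enters only through the shared crux ManinOddAtFour (not attacked here) and through conductor
exponents f₂ ≤ 6 of the inner twists (BarriosEtAl2025), no 2-adic Iwasawa theory.
- Negatives index: one entry (stmt-15532, LeadingTermTamePinch: existence of an ordinary prime ≥ 5)
— unrelated; no Manin/twist statement is refuted at filing.

History (route lifecycle, newest last):
- 2026-08-28T10:20:21Z · rev 20: informal re-worded for SupersingularStrongIsUnstarred (planner-bsd-idea-3-g6-0)
- 2026-08-28T11:03:09Z · rev 21: informal re-worded for EisensteinCornerManinResidual (planner-bsd-idea-3-g7-0)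
- 2026-08-28T11:04:48Z · rev 21: informal re-worded for EisensteinCornerManinResidual (planner-bsd-idea-3-g7-0)
- 2026-08-28T11:14:32Z · rev 23: informal re-worded for OrdinaryCornerManinResidual (planner-bsd-idea-3-g7-0)
- 2026-08-28T11:36:48Z · rev 25: informal re-worded for OrdinaryCornerManinResidual (planner-bsd-idea-3-g7-0)
- 2026-08-28T12:06:13Z · rev 28: informal re-worded for OrdinaryCornerDeepEdixhovenDichotomy (planner-bsd-idea-3-g7-0)
- 2026-08-28T12:07:17Z · rev 29: informal re-worded for OrdinaryCornerDeepEdixhovenDichotomy (planner-bsd-idea-3-g7-0)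
- 2026-08-29T13:37:08Z · rev 31: restated EisensteinResidualOfTrichotomy (stmt-BirchSwinnertonDyer-25945) — re-key glue 25945 per bsd-line-ttd-p1 g16 ask (REQUESTS l.49157): antecedent LargePrimeReducibleJ (already binder hL of closes) added in front; by-name closer e (planner-bsd-idea-3-g13-0)

sub-problem: BirchSwinnertonDyer · status: open · opened planner-bsd-idea-3-g4-0 2026-08-28T03:06:33Z · rev 32 · ledger route-BirchSwinnertonDyer-TwistFamilyManinDescent
GENERATED by the gate from the ledger (D-0016/17). Provers cite these decls: `theorem foo : Summit.BirchSwinnertonDyer.BirchSwinnertonDyer.Theses.TwistFamilyManinDescent.<Decl> := …` in Summits/BirchSwinnertonDyer/BirchSwinnertonDyer/Theorems/<Name>.lean.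
-/

namespace Summit.BirchSwinnertonDyer.BirchSwinnertonDyer.Theses.TwistFamilyManinDescent

open scoped BigOperators Topology Manifold Classical MeasureTheory ProbabilityTheory Matrix InnerProductSpace ComplexConjugate ContinuousMap
open Filter Set Function TopologicalSpace MeasureTheory

attribute [summit_statement] _root_.BirchSwinnertonDyer
attribute [summit_statement] _root_.Summit.BirchSwinnertonDyer.Rank1Residual.ManinConstant.ManinConstantOne

open Literature

/-! Retired items kept as plain definitions (history; not obligations of this route): landed proofs / closed glue still name them. -/

/-- retired stmt-BirchSwinnertonDyer-26289 (moot, gen 1) — named by an active item. -/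
def EisensteinCornerManinResidual : Prop :=
  Literature.NumberTheory.EllipticCurves.ModularForms.mazur_not_dvd_maninConstant_of_odd → Literature.NumberTheory.EllipticCurves.ModularForms.abbesUllmo_not_dvd_maninConstant_of_not_dvd_level → Literature.NumberTheory.EllipticCurves.ModularForms.cesnavicius_not_two_dvd_maninConstant_of_two_dvd_level → Literature.NumberTheory.EllipticCurves.ModularForms.exists_isNewformOf → ∀ (W : WeierstrassCurve ℚ) [W.IsElliptic] [W.IsGloballyMinimal] {N : ℕ} [NeZero N] (D : Literature.NumberTheory.EllipticCurves.ModularForms.ModularParametrizationData W N) (p : ℕ) (hp : p.Prime), (p = 5 ∨ p = 7) → ¬ ((p = 5 ∧ padicValInt 5 W.minimalDiscriminantInt ∈ ({4, 8} : Finset ℕ)) ∨ (p = 7 ∧ padicValInt 7 W.minimalDiscriminantInt ∈ ({3, 9} : Finset ℕ))) → p ^ 2 ∣ N → ¬ W.HasIrreducibleModPGaloisRep p → ¬ ((W.quadraticTwist (((-1 : ℤ) ^ (p / 2) * p : ℤ) : ℚ)).HasGoodReductionAt ((Rat.HeightOneSpectrum.primesEquiv (R := ℤ)).symm ⟨p,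 hp⟩) ∨ (W.quadraticTwist (((-1 : ℤ) ^ (p / 2) * p : ℤ) : ℚ)).HasMultiplicativeReductionAt ((Rat.HeightOneSpectrum.primesEquiv (R := ℤ)).symm ⟨p, hp⟩)) → (∀ z ∈ D.L.lattice, ∃ w ∈ Literature.NumberTheory.EllipticCurves.ModularForms.periodLattice D.f, z = D.c * w) → ¬ (p : ℤ) ∣ D.maninConstant

/-- retired stmt-BirchSwinnertonDyer-26325 (moot, gen 1) — named by an active item. -/
def EisensteinRaynaudRegimeManinUnit : Prop :=
  Literature.NumberTheory.EllipticCurves.ModularForms.mazur_not_dvd_maninConstant_of_odd → Literature.NumberTheory.EllipticCurves.ModularForms.abbesUllmo_not_dvd_maninConstant_of_not_dvd_level → Literature.NumberTheory.EllipticCurves.ModularForms.cesnavicius_not_two_dvd_maninConstant_of_two_dvd_level → Literature.NumberTheory.EllipticCurves.ModularForms.exists_isNewformOf → ∀ (W : WeierstrassCurve ℚ) [W.IsElliptic] [W.IsGloballyMinimal] {N : ℕ} [NeZero N] (D : Literature.NumberTheory.EllipticCurves.ModularForms.ModularParametrizationData W N) (p : ℕ) (hp : p.Prime), ((p = 5 ∧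 padicValInt 5 W.minimalDiscriminantInt ∈ ({4, 8} : Finset ℕ)) ∨ (p = 7 ∧ padicValInt 7 W.minimalDiscriminantInt ∈ ({3, 9} : Finset ℕ))) → p ^ 2 ∣ N → ¬ W.HasIrreducibleModPGaloisRep p → ¬ ((W.quadraticTwist (((-1 : ℤ) ^ (p / 2) * p : ℤ) : ℚ)).HasGoodReductionAt ((Rat.HeightOneSpectrum.primesEquiv (R := ℤ)).symm ⟨p, hp⟩) ∨ (W.quadraticTwist (((-1 : ℤ) ^ (p / 2) * p : ℤ) : ℚ)).HasMultiplicativeReductionAt ((Rat.HeightOneSpectrum.primesEquiv (R := ℤ)).symm ⟨p, hp⟩)) → (∀ z ∈ D.L.lattice, ∃ w ∈ Literature.NumberTheory.EllipticCurves.ModularForms.periodLattice D.f, z = D.c * w) → ¬ (p : ℤ) ∣ D.maninConstant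

/-- item stmt-BirchSwinnertonDyer-25136 · crux · rank 2 · closed · proved by Summit.BirchSwinnertonDyer.BirchSwinnertonDyer.Theorems.TwistFamilyManinDescent.twistFamilyDescent_proof (prover) · by planner
why it might fail: the step needs f_W exactly the χ_{q*}-twist of the partner's newform and q² ∣ N(W); at q = 3 ∣ d₁ with E₀ semistable at 3 the twist is tame (f₃ = 2) so it holds — a failure would be a conductor-exponent slip at q = 3, not at q ≥ 5.
sources: Stevens1989, AgasheRibetStein2006, EdixhovenManin1991, SilvermanAEC2009
[crux] WHOLE-FAMILY DESCENT. Given modularity: for E₀/ℚ elliptic and A ∈ ℕ divisible by every odd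
additive prime of E₀, for d₀, d₁ ≠ 0 with d₁ coprime to 2·A·d₀: if the classes of E₀ ⊗ d₀ and E₀ ⊗
(−d₀) satisfy the class Manin certificate (|c| = 1 for every lattice-optimal X₀-datum of every
globally minimal member), so does the class of E₀ ⊗ (d₀d₁). Proof plan: reduce d₁ to squarefree
(variable change ⇒ isogenous, `ClassAbsManinConstantEqOne.of_isIsogenous`); induct on the odd primes
q ∣ d₁: E₀ semistable at q (q ∤ A), W = E₀ ⊗ d₀d₁ additive at q with q² ∣ N(W), W ⊗ q* ≅ E₀ ⊗
(d₀d₁/q · ±1) semistable at q (`hasReductionAt_quadraticTwist_iff_of_not_dvd`,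
`quadraticTwist_quadraticTwist`, `exists_variableChange_quadraticTwist_mul_sq`), one step =
`classAbsManinConstantEqOne_of_quadraticTwist_pStar`; the sign lands on ±d₀. [difficulty: M] -/
@[route_item "route-BirchSwinnertonDyer-TwistFamilyManinDescent", crux]
def TwistFamilyDescent : Prop :=
  Literature.NumberTheory.EllipticCurves.ModularForms.exists_isNewformOf → ∀ (E₀ : WeierstrassCurve ℚ) [E₀.IsElliptic] (A : ℕ), (∀ (q : ℕ) [Fact q.Prime], q ≠ 2 → Literature.NumberTheory.EllipticCurves.Rank1Residual.Addv E₀ q → q ∣ A) → ∀ d₀ d₁ : ℤ, d₀ ≠ 0 → d₁ ≠ 0 → IsCoprime d₁ (2 * A * d₀) → Literature.NumberTheory.EllipticCurves.ModularForms.ClassAbsManinConstantEqOne (E₀.quadraticTwist ((d₀ : ℤ) : ℚ)) → Literature.NumberTheory.EllipticCurves.ModularForms.ClassAbsManinConstantEqOne (E₀.quadraticTwist ((-d₀ : ℤ) : ℚ)) → Literature.NumberTheory.EllipticCurves.ModularForms.ClassAbsManinConstantEqOne (E₀.quadraticTwist ((d₀ * d₁ : ℤ) : ℚ))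

-- `TwistFamilyDescent` holds: proved by `Summit.BirchSwinnertonDyer.BirchSwinnertonDyer.Theorems.TwistFamilyManinDescent.twistFamilyDescent_proof` (its module imports this route file, so no `_holds` link can be stated here).

/-- item stmt-BirchSwinnertonDyer-25137 · crux · rank 3 · closed · proved by Summit.BirchSwinnertonDyer.BirchSwinnertonDyer.Theorems.TwistFamilyManinDescent.isogenyTableFamiliesManinOne_proof (prover) · by planner
why it might fail: an inner twist outside Cremona's range: the instrument row is the conductor of 14450 ⊗ (±2·5·17) = 2⁶·5²·17² = 462400 < 5·10⁵ (tightest); j(−163) ⊗ χ±8 has 2⁶·163² = 1700416 > 5·10⁵ and is EXCLUDED (sent to the residual corner).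
sources: CremonaAlgorithms1997, AgasheRibetStein2006, Kenku1982, Mazur1978, arXiv:2409.16248
[crux] THE ISOGENY-TABLE FAMILIES (beyond print; infinitely many classes of unbounded conductor).
Given modularity and Cremona's |c| = 1 for N ≤ 500000: every elliptic W/ℚ with j ∈ {−2¹⁵, −11²,
−11·131³, −17²·101³/2, −17·373³/2¹⁷, −96³, −7·11³, −7·137³·2083³, −960³, −5280³}, or with j =
−640320³ and 2⁶ ∤ N(W), satisfies the class Manin certificate. Plan: W ≅ E₀ ⊗ d for the base model
E₀ of that j (`exists_variableChange_eq_quadraticTwist_of_j_eq`, j ≠ 0, 1728); TwistFamilyDescent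
with A = rad of the odd additive primes of E₀ (11 | 5·17 | 19 | 5·7 | 43 | 67 | 163); the ≤ 16 inner
twists E₀ ⊗ (±d₀), d₀ ∣ 2·A squarefree, have conductor ≤ 2⁶·5²·17² = 462400 (BarriosEtAl2025 dyadic
exponents `conductorExponent_quadraticTwist_of_hasGoodReductionAt` / `…_two_of_le_one_holds`, f_p ≤
2 for p ≥ 5) hence |c| = 1 by `classAbsManinConstantEqOne_of_conductorNorm_le_500000`; for −640320³
only odd d₀ (2⁶ ∤ N): 26569, 425104. [deps: TwistFamilyDescent] [difficulty: L] -/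
@[route_item "route-BirchSwinnertonDyer-TwistFamilyManinDescent", crux]
def IsogenyTableFamiliesManinOne : Prop :=
  Literature.NumberTheory.EllipticCurves.ModularForms.exists_isNewformOf → Literature.NumberTheory.EllipticCurves.cremona_abs_maninConstant_eq_one_of_level_le_500000 → ∀ (W : WeierstrassCurve ℚ) [W.IsElliptic], (W.j ∈ ({-32768, -121, -24729001, -297756989 / 2, -882216989 / 131072, -884736, -9317, -162677523113838677, -884736000, -147197952000} : Finset ℚ) ∨ (W.j = -262537412640768000 ∧ ¬ 2 ^ 6 ∣ W.conductorNorm ℤ)) → Literature.NumberTheory.EllipticCurves.ModularForms.ClassAbsManinConstantEqOne W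

-- `IsogenyTableFamiliesManinOne` holds: proved by `Summit.BirchSwinnertonDyer.BirchSwinnertonDyer.Theorems.TwistFamilyManinDescent.isogenyTableFamiliesManinOne_proof` (its module imports this route file, so no `_holds` link can be stated here).

/-- item stmt-BirchSwinnertonDyer-25138 · crux · rank 4 · closed · proved by Summit.BirchSwinnertonDyer.BirchSwinnertonDyer.Theorems.TwistFamilyManinDescentCdtThm1.EisensteinAdditiveManinResidual_proof (prover) · by planner
why it might fail: it is Manin's conjecture at an Eisenstein additive prime p ∈ {5,7,13}: one optimal curve with 25 ∣ N, a rational 5-isogeny, W ⊗ χ₅ additive and 5 ∣ c beyond N = 500000 refutes it; no printed method reaches e_p ≥ 3 with E[p] reducible.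
sources: EdixhovenManin1991, arXiv:1705.09251, CesnaviciusNeururerSaha2023, Mazur1978
retired/moot children: EisensteinResidualOfTrichotomy [moot: LargePrimeReducibleJ → EisensteinOrdinaryTwistLatticeNotBottom → EisensteinOrdin]; EisensteinOrdinaryTwistLatticeNotBottom [moot: ∀ (W : WeierstrassCurve ℚ) [W.IsElliptic] [W.IsGloballyMinimal] (p : ℕ) [Fact p.]; EisensteinOrdinaryStrongIsTop [replaced: ∀ (W : WeierstrassCurve ℚ) [W.IsElliptic] [W.IsGloballyMinimal] (p : ℕ) [Fact p.]; EdixhovenLargePrimeManinFacts [moot: Literature.NumberTheory.EllipticCurves.ModularForms.edixhoven_not_dvd_maninConst]; EisensteinRaynaudRegimeManinUnit [replaced: Literature.NumberTheory.EllipticCurves.ModularForms.mazur_not_dvd_maninConstant_]; EisensteinCornerManinResidual [replaced: Literature.NumberTheory.EllipticCurves.ModularForms.mazur_not_dvd_maninConstant_]; EisensteinResidualOfTrichotomy [replaced: EisensteinOrdinaryTwistLatticeNotBottom → EisensteinOrdinaryStrongIsTop → Edixho]; EisensteinCornerManinResidual [moot: Literature.NumberTheory.EllipticCurves.ModularFo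rms.mazur_not_dvd_maninConstant_]
[crux] DECLARED RESIDUAL (the honest open core of X₅ after this line; not attacked here). Given the
printed semistable facts and modularity: for W globally minimal with a lattice-optimal X₀(N)-datum,
p ∈ {5, 7, 13} — or p = 163 with 2⁶ ∣ N — with p² ∣ N, E[p] REDUCIBLE and W ⊗ χ_{p*} NOT semistable
at p (twist-minimal additive: potentially good, e_p ∈ {3, 4, 6}), p ∤ c. These are the
rational-p-isogeny curves of genus-0 level (X₀(5), X₀(7), X₀(13): infinitely many j) at their
additive twist-minimal fibres, where Raynaud e < p − 1 and the Kato road (needs Irr) are both void.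
[difficulty: open-problem] -/
@[route_item "route-BirchSwinnertonDyer-TwistFamilyManinDescent", crux]
def EisensteinAdditiveManinResidual : Prop :=
  Literature.NumberTheory.EllipticCurves.ModularForms.mazur_not_dvd_maninConstant_of_odd → Literature.NumberTheory.EllipticCurves.ModularForms.abbesUllmo_not_dvd_maninConstant_of_not_dvd_level → Literature.NumberTheory.EllipticCurves.ModularForms.cesnavicius_not_two_dvd_maninConstant_of_two_dvd_level → Literature.NumberTheory.EllipticCurves.ModularForms.exists_isNewformOf → ∀ (W : WeierstrassCurve ℚ) [W.IsElliptic] [W.IsGloballyMinimal] {N : ℕ} [NeZero N] (D : Literature.NumberTheory.EllipticCurves.ModularForms.ModularParametrizationData W N) (p : ℕ) (hp : p.Prime), (p = 5 ∨ p = 7 ∨ p = 13 ∨ (p = 163 ∧ 2 ^ 6 ∣ N)) → p ^ 2 ∣ N → ¬ W.HasIrreducibleModPGaloisRep p → ¬ ((W.quadraticTwist (((-1 : ℤ) ^ (p / 2) * p : ℤ) : ℚ)).HasGoodReductionAt ((Rat.HeightOneSpectrum.primesEquiv (R := ℤ)).symm ⟨p, hp⟩) ∨ (W.quadraticTwist (((-1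 : ℤ) ^ (p / 2) * p : ℤ) : ℚ)).HasMultiplicativeReductionAt ((Rat.HeightOneSpectrum.primesEquiv (R := ℤ)).symm ⟨p, hp⟩)) → (∀ z ∈ D.L.lattice, ∃ w ∈ Literature.NumberTheory.EllipticCurves.ModularForms.periodLattice D.f, z = D.c * w) → ¬ (p : ℤ) ∣ D.maninConstant

-- `EisensteinAdditiveManinResidual` holds: proved by `Summit.BirchSwinnertonDyer.BirchSwinnertonDyer.Theorems.TwistFamilyManinDescentCdtThm1.EisensteinAdditiveManinResidual_proof` (its module imports this route file, so no `_holds` link can be stated here).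

-- parent: EisensteinAdditiveManinResidual · child (gen 1)
/--     item stmt-BirchSwinnertonDyer-25942 · support · rank 404 · closed · proved by Summit.BirchSwinnertonDyer.BirchSwinnertonDyer.Theorems.TwistFamilyManinDescent.cmCornerNotOrdinaryAtOneSixtyThree_proof (prover)
    parent: EisensteinAdditiveManinResidual · by planner
    sources: Mazur1978, Kenku1982, CremonaAlgorithms1997
[support] known mathematics, M-sized formalization: under the prime-degree isogeny j-table fact
(Mazur 1978 / Kenku 1982, typed as `primeDegreeIsogeny_jTable`), a curve with E[163] reducible has j
= −640320³, hence CM by the order of discriminant −163 (`hasCM`), and 163 ≡ 3 mod 4 is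
inert-or-ramified there (ramified), so by Deuring
(`deuring_not_hasUnitRootAt_of_hasCM_of_not_cmSplit_holds`, landed) W is NOT (G)-ordinary at 163:
¬TypeGOrd W 163. Feeds the p = 163 ∧ 2⁶ ∣ N rows of R into the (G)-ordinary-exception form of
Edixhoven Thm 3 (EdixhovenLargePrimeManinFacts.2). The jTable fact is a hypothesis of this item (not
the route's top-level LargePrimeReducibleJ, which renders later in the file). -/
@[route_item "route-BirchSwinnertonDyer-TwistFamilyManinDescent"]
def CMCornerNotOrdinaryAtOneSixtyThree : Prop :=
  Literature.NumberTheory.EllipticCurves.primeDegreeIsogeny_jTable → ∀ (W : WeierstrassCurve ℚ) [W.IsElliptic], ¬ W.HasIrreducibleModPGaloisRep 163 → ¬ Summit.BirchSwinnertonDyer.Rank1Residual.Additive.TypeGOrd W 163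

-- `CMCornerNotOrdinaryAtOneSixtyThree` holds: proved by `Summit.BirchSwinnertonDyer.BirchSwinnertonDyer.Theorems.TwistFamilyManinDescent.cmCornerNotOrdinaryAtOneSixtyThree_proof` (its module imports this route file, so no `_holds` link can be stated here).

/-- item stmt-BirchSwinnertonDyer-22967 · crux · rank 5 · closed · proved by Summit.BirchSwinnertonDyer.BirchSwinnertonDyer.Theorems.ManinLocalTwoThree.ManinOddAtFour_proof (prover) · by planner
why it might fail: a class with 4 ∣ N, Γ₁-constant 1 but c₀ = 2 (ČNS Lemma 6.5 allows c₀/c₁ ∈ {1,2}; Stevens' η = 2 exists) refutes it; twist-minimal classes v₂(N) ∈ {5,…,8} have no semistable partner.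
sources: Cesnavicius2018, CesnaviciusNeururerSaha2023, Stevens1989
[crux] EDIT 2 (birth repair): the three printed semistable-prime facts (Mazur 1978 Cor. 4.1,
Abbes–Ullmo 1996 Thm. A, Česnavičius 2018 Thm. 1.2) and the Modularity Theorem `exists_isNewformOf`
(Diamond–Shurman Thm. 8.8.3 = Wiles / Taylor–Wiles / BCDT 2001) as explicit hypotheses (the `(h :
Fact) →` form in which the tree's twist-transport certificates consume them); body unchanged. For
every globally minimal W/ℚ, every level N with 4 ∣ N and every X₀(N)-datum D of W with Λ_W = c·Λ_f
(optimal parametrisation), the Manin constant c is odd — Manin's conjecture at the prime 2 for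
curves additive at 2, GIVEN the printed facts and modularity. [deps: PrintedSemistableManinFacts
(whose fourth conjunct is the Modularity Theorem)] [difficulty: open-problem] -/
@[route_item "route-BirchSwinnertonDyer-TwistFamilyManinDescent", crux]
def ManinOddAtFour : Prop :=
  Literature.NumberTheory.EllipticCurves.ModularForms.mazur_not_dvd_maninConstant_of_odd → Literature.NumberTheory.EllipticCurves.ModularForms.abbesUllmo_not_dvd_maninConstant_of_not_dvd_level → Literature.NumberTheory.EllipticCurves.ModularForms.cesnavicius_not_two_dvd_maninConstant_of_two_dvd_level → Literature.NumberTheory.EllipticCurves.ModularForms.exists_isNewformOf → ∀ (W : WeierstrassCurve ℚ) [W.IsElliptic] [W.IsGloballyMinimal] {N : ℕ} [NeZero N] (D : Literature.NumberTheory.EllipticCurves.ModularForms.ModularParametrizationData W N), (∀ z ∈ D.L.lattice, ∃ w ∈ Literature.NumberTheory.EllipticCurves.ModularForms.periodLattice D.f, z = D.c * w) → 2 ^ 2 ∣ N → ¬ (2 : ℤ) ∣ D.maninConstant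

/-- `ManinOddAtFour` holds: proved by `Summit.BirchSwinnertonDyer.BirchSwinnertonDyer.Theorems.ManinLocalTwoThree.ManinOddAtFour_proof`. -/
theorem ManinOddAtFour_holds : ManinOddAtFour := _root_.Summit.BirchSwinnertonDyer.BirchSwinnertonDyer.Theorems.ManinLocalTwoThree.ManinOddAtFour_proof

/-- item stmt-BirchSwinnertonDyer-22968 · crux · rank 6 · closed · proved by Summit.BirchSwinnertonDyer.BirchSwinnertonDyer.Theorems.ManinLocalTwoThree.ManinPrimeToThreeAtNine_proof (prover) · by planner
why it might fail: twist-minimal classes at 3 (27 ∣ N) have no transport partner; ČNS give only v₃(c) ≤ v₃(deg φ) and 3 ∣ deg φ is forced on whole families; Raynaud e < p − 1 fails at p = 3.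
sources: CesnaviciusNeururerSaha2023, EdixhovenManin1991, Stevens1989
[crux] EDIT 2 (birth repair): the three printed semistable-prime facts (Mazur 1978 Cor. 4.1,
Abbes–Ullmo 1996 Thm. A, Česnavičius 2018 Thm. 1.2) and the Modularity Theorem `exists_isNewformOf`
(Diamond–Shurman Thm. 8.8.3 = Wiles / Taylor–Wiles / BCDT 2001) as explicit hypotheses (the `(h :
Fact) →` form in which the tree's twist-transport certificates consume them); body unchanged. For
every globally minimal W/ℚ, every level N with 9 ∣ N and every optimal X₀(N)-datum D of W (lattice
clause), 3 ∤ c — Manin's conjecture at the prime 3 for curves additive at 3, GIVEN the printed facts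
and modularity. [deps: PrintedSemistableManinFacts (whose fourth conjunct is the Modularity
Theorem)] [difficulty: open-problem] -/
@[route_item "route-BirchSwinnertonDyer-TwistFamilyManinDescent", crux]
def ManinPrimeToThreeAtNine : Prop :=
  Literature.NumberTheory.EllipticCurves.ModularForms.mazur_not_dvd_maninConstant_of_odd → Literature.NumberTheory.EllipticCurves.ModularForms.abbesUllmo_not_dvd_maninConstant_of_not_dvd_level → Literature.NumberTheory.EllipticCurves.ModularForms.cesnavicius_not_two_dvd_maninConstant_of_two_dvd_level → Literature.NumberTheory.EllipticCurves.ModularForms.exists_isNewformOf → ∀ (W : WeierstrassCurve ℚ) [W.IsElliptic] [W.IsGloballyMinimal] {N : ℕ} [NeZero N] (D : Literature.NumberTheory.EllipticCurves.ModularForms.ModularParametrizationData W N), (∀ z ∈ D.L.lattice, ∃ w ∈ Literature.NumberTheory.EllipticCurves.ModularForms.periodLattice D.f, z = D.c * w) → 3 ^ 2 ∣ N → ¬ (3 : ℤ) ∣ D.maninConstant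

/-- `ManinPrimeToThreeAtNine` holds: proved by `Summit.BirchSwinnertonDyer.BirchSwinnertonDyer.Theorems.ManinLocalTwoThree.ManinPrimeToThreeAtNine_proof`. -/
theorem ManinPrimeToThreeAtNine_holds : ManinPrimeToThreeAtNine := _root_.Summit.BirchSwinnertonDyer.BirchSwinnertonDyer.Theorems.ManinLocalTwoThree.ManinPrimeToThreeAtNine_proof

/-- item stmt-BirchSwinnertonDyer-22969 · support · rank 9 · closed · proved by Summit.BirchSwinnertonDyer.BirchSwinnertonDyer.Theorems.ManinLocalTwoThree.ManinPrimeToAdditiveFiveLe_proof (prover) · by planner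
sources: EdixhovenManin1991, CesnaviciusNeururerSaha2023
[crux] EDIT 2 (birth repair) + residual-boundary amendment (Q-ref2-7): the three printed
semistable-prime facts (Mazur 1978 Cor. 4.1, Abbes–Ullmo 1996 Thm. A, Česnavičius 2018 Thm. 1.2) and
the Modularity Theorem `exists_isNewformOf` (Diamond–Shurman Thm. 8.8.3 = Wiles / Taylor–Wiles /
BCDT 2001) as explicit hypotheses (the `(h : Fact) →` form in which the tree's twist-transport
certificates consume them); body unchanged. RESIDUAL conjunct (declared residual, not attacked by
this cell): for every globally minimal W/ℚ, every N and every optimal X₀(N)-datum D of W, every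
prime p ≥ 5 with p² ∣ N satisfies p ∤ c, GIVEN the printed facts and modularity (open at p = 5, 7
and at p ≥ 11 of potentially ordinary Kodaira type II/III/IV; the rest is Edixhoven 1991 Thm. 3 —
which itself uses modularity — FOR W[p] IRREDUCIBLE (the printed §4 chain, repaired on flip rows by
the cell's E-an-31) or p ∉ {11, 17}; for W[p] REDUCIBLE at additive p ∈ {11, 17} (j ∈ {−11²,
−11·131³, −17²·101³/2, −17·373³/2¹⁷} and their prime-to-p quadratic twists) the printed chain is
contradicted by the flip pair 121c1/121a1 and p ∤ c rests on Edixhoven's unpublished thesis Thm.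
4.6.3 (acq-13486) — not safely in print — -/
@[route_item "route-BirchSwinnertonDyer-TwistFamilyManinDescent", crux]
def ManinPrimeToAdditiveFiveLe : Prop :=
  Literature.NumberTheory.EllipticCurves.ModularForms.mazur_not_dvd_maninConstant_of_odd → Literature.NumberTheory.EllipticCurves.ModularForms.abbesUllmo_not_dvd_maninConstant_of_not_dvd_level → Literature.NumberTheory.EllipticCurves.ModularForms.cesnavicius_not_two_dvd_maninConstant_of_two_dvd_level → Literature.NumberTheory.EllipticCurves.ModularForms.exists_isNewformOf → ∀ (W : WeierstrassCurve ℚ) [W.IsElliptic] [W.IsGloballyMinimal] {N : ℕ} [NeZero N] (D : Literature.NumberTheory.EllipticCurves.ModularForms.ModularParametrizationData W N), (∀ z ∈ D.L.lattice, ∃ w ∈ Literature.NumberTheory.EllipticCurves.ModularForms.periodLattice D.f, z = D.c * w) → ∀ p : ℕ, p.Prime → 5 ≤ p → p ^ 2 ∣ N → ¬ (p : ℤ) ∣ D.maninConstant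

/-- `ManinPrimeToAdditiveFiveLe` holds: proved by `Summit.BirchSwinnertonDyer.BirchSwinnertonDyer.Theorems.ManinLocalTwoThree.ManinPrimeToAdditiveFiveLe_proof`. -/
theorem ManinPrimeToAdditiveFiveLe_holds : ManinPrimeToAdditiveFiveLe := _root_.Summit.BirchSwinnertonDyer.BirchSwinnertonDyer.Theorems.ManinLocalTwoThree.ManinPrimeToAdditiveFiveLe_proof

/-- item stmt-BirchSwinnertonDyer-22970 · support · rank 9 · open · by planner
sources: Mazur1978, AbbesUllmo1996, Cesnavicius2018, DiamondShurman2005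
[support] EDIT 2 (birth repair): the printed facts the cruxes are conditioned on, by name, as ONE
conjunction: Mazur 1978 Cor. 4.1 (odd p, p² ∤ N ⇒ p ∤ c), Abbes–Ullmo 1996 Thm. A (p ∤ N ⇒ p ∤ c),
Česnavičius 2018 Thm. 1.2 (2 ∥ N ⇒ 2 ∤ c) in the tree's lattice rendering, AND (fourth conjunct,
new) the Modularity Theorem `exists_isNewformOf` (Diamond–Shurman Thm. 8.8.3 = Wiles 1995 /
Taylor–Wiles / BCDT 2001; a named Literature fact without `_holds`, consumed as the hypothesis `hnf`
by every tree twist-transport certificate). Literature facts consumed as hypotheses (precedent: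
AdditiveKolyvaginRoad.MazurManinConstantOddPrimes). Folding modularity in here keeps the `Assembly`
statement and the deciding theorem `closes` byte-identical to the birth file. [difficulty: routine —
it is a hypothesis bundle, never a proof target] -/
@[route_item "route-BirchSwinnertonDyer-TwistFamilyManinDescent", crux]
def PrintedSemistableManinFacts : Prop :=
  Literature.NumberTheory.EllipticCurves.ModularForms.mazur_not_dvd_maninConstant_of_odd ∧ Literature.NumberTheory.EllipticCurves.ModularForms.abbesUllmo_not_dvd_maninConstant_of_not_dvd_level ∧ Literature.NumberTheory.EllipticCurves.ModularForms.cesnavicius_not_two_dvd_maninConstant_of_two_dvd_level ∧ Literature.NumberTheory.EllipticCurves.ModularForms.exists_isNewformOf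

/-- item stmt-BirchSwinnertonDyer-25139 · support · rank 9 · open · by planner
sources: Mazur1978, Kenku1982, CremonaAlgorithms1997
[support] KNOWN (Mazur 1978 Thm. 1 + Ligozat 1975 / Mazur–Swinnerton-Dyer 1974 / Kenku 1982: the
rational points of X₀(ℓ), ℓ ∈ {11,17,19,37,43,67,163}; Cremona 1997 §3.8 p. 82): an elliptic W/ℚ
with E[p] reducible for a prime p ≥ 11, p ≠ 13 has (p, j(W)) in the tree's
`largePrimeIsogenyJTable`. From the named facts `mazur_isogeny_irreducible` +
`primeDegreeIsogeny_jTable` + (reducible ⇒ rational p-isogeny). [difficulty: M] -/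
@[route_item "route-BirchSwinnertonDyer-TwistFamilyManinDescent", crux]
def LargePrimeReducibleJ : Prop :=
  ∀ (W : WeierstrassCurve ℚ) [W.IsElliptic] (p : ℕ) [Fact p.Prime], 11 ≤ p → p ≠ 13 → ¬ Literature.NumberTheory.EllipticCurves.Rank1Residual.Irr W p → (p, W.j) ∈ Literature.NumberTheory.EllipticCurves.largePrimeIsogenyJTable

/-- item stmt-BirchSwinnertonDyer-25140 · support · rank 9 · closed · proved by Summit.BirchSwinnertonDyer.BirchSwinnertonDyer.Theorems.TwistFamilyManinDescent.irreducibleAdditiveManinUnit_proof (prover) · by planner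
sources: Kato2004Asterisque, DiamondRibet1997, KostersPannekoek2017
[support] PROVABLE NOW (one line, `Sketch10.lean` `irreducibleAdditiveManinUnit_holds`): given
modularity, F″ (Kato–Néron integrality) and Ihara³, for W globally minimal additive at p ≥ 5 with
E[p] irreducible and D lattice-optimal at any level, p ∤ c —
`TeichmullerTwistDescent.not_dvd_c_of_kato_of_iharaSq_of_witness` with the discharged Chebotarev
witness `NonEisensteinWitness.lTwistWitness`. [difficulty: provable-now] -/
@[route_item "route-BirchSwinnertonDyer-TwistFamilyManinDescent", crux]
def IrreducibleAdditiveManinUnit : Prop :=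
  Literature.NumberTheory.EllipticCurves.ModularForms.exists_isNewformOf → Literature.NumberTheory.EllipticCurves.kato_neron_isIntegral_twistedSymbolSum_of_additive_five_le → Literature.NumberTheory.EllipticCurves.ModularForms.diamondRibet1997_iharaLemma_sq → ∀ (W : WeierstrassCurve ℚ) [W.IsElliptic] [W.IsGloballyMinimal] (p : ℕ) [Fact p.Prime] {N : ℕ} [NeZero N] (D : Literature.NumberTheory.EllipticCurves.ModularForms.ModularParametrizationData W N), 5 ≤ p → Literature.NumberTheory.EllipticCurves.Rank1Residual.Addv W p → Literature.NumberTheory.EllipticCurves.Rank1Residual.Irr W p → (∀ z ∈ D.L.lattice, ∃ w ∈ Literature.NumberTheory.EllipticCurves.ModularForms.periodLattice D.f, z = D.c * w) → ¬ (p : ℤ) ∣ D.maninConstant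

-- `IrreducibleAdditiveManinUnit` holds: proved by `Summit.BirchSwinnertonDyer.BirchSwinnertonDyer.Theorems.TwistFamilyManinDescent.irreducibleAdditiveManinUnit_proof` (its module imports this route file, so no `_holds` link can be stated here).

/-- item stmt-BirchSwinnertonDyer-25141 · support · rank 9 · open · by planner
sources: Kato2004Asterisque, DiamondRibet1997, CremonaAlgorithms1997, AgasheRibetStein2006
[support] Hypothesis bundle (cite-only Literature facts displayed, never asserted): F″ = Kato–Néron
integrality of twisted modular-symbol sums at additive p ≥ 5 ∧ Ihara³ (Diamond–Ribet 1997 Lemma 4.6)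
∧ Cremona's |c| = 1 for every lattice-optimal X₀(N)-datum with N ≤ 500000. [difficulty: S] -/
@[route_item "route-BirchSwinnertonDyer-TwistFamilyManinDescent", crux]
def KatoIharaCremonaFacts : Prop :=
  Literature.NumberTheory.EllipticCurves.kato_neron_isIntegral_twistedSymbolSum_of_additive_five_le ∧ Literature.NumberTheory.EllipticCurves.ModularForms.diamondRibet1997_iharaLemma_sq ∧ Literature.NumberTheory.EllipticCurves.cremona_abs_maninConstant_eq_one_of_level_le_500000

/-- item stmt-BirchSwinnertonDyer-26990 · support · rank 9 · open · by operator
sources: Stevens 1989, Invent. Math. 98, §2, Vatsal 2005, Thm 1.3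
StevensSecondHalf — Stevens 1989, second half (Invent. Math. 98; cf. Vatsal 2005 Thm 1.3): for the
X_1(N)-optimal curve E_1 of an isogeny class and every globally minimal W isogenous to it — (L1)
lattice inclusion Λ_{E_1} ⊆ Λ_W; (L2) an étale isogeny E_1 → W (φ^*ω_W = ω_{E_1}); (L3) minimal
Faltings height h(E_1) ≤ h(W). NEEDS-MATERIALISE: signature to be filled by the gate pen with the
one-line Prop over tree decls (21-frontier X1-b ruling 2026-08-31T21:42:34Z, steps 1–2) once the
extension's definitions are in the tree. Pointer:
pub/bsd-manin-audit/extensions/StevensFull/{Skeleton.lean 390e52f36f411b88, StevensFull.lean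
4d7162960f5d6ef5} (theorems neronLattice_le_of_isIsogenous, exists_etaleIsogeny_of_isIsogenous,
faltingsHeight_le_of_isIsogenous). As typed, under audit; X1-a CLEAN (STEVENSFULL-REF-X1a.md
2a6a753637b8b4ae). Annex support item on TFMD, not a TFMD crux; R3: TFMD remains HELD;
count-neutral. -/
@[route_item "route-BirchSwinnertonDyer-TwistFamilyManinDescent"]
def StevensSecondHalf : Prop :=
  (∀ {N : ℕ} [NeZero N] {E₁ W : WeierstrassCurve ℚ} [E₁.IsElliptic] [E₁.IsGloballyMinimal] [W.IsElliptic] [W.IsGloballyMinimal] (D₁ : Literature.NumberTheory.EllipticCurves.ModularForms.Gamma1ParametrizationData E₁ N), D₁.IsOptimal → WeierstrassCurve.IsIsogenous E₁ W → ∀ {L : PeriodPair}, Literature.NumberTheory.EllipticCurves.ModularForms.IsNeronLatticeOf (W.baseChange ℂ) L → D₁.L.lattice ≤ L.lattice) ∧ (∀ {N : ℕ} [NeZero N] {E₁ W : WeierstrassCurve ℚ} [E₁.IsElliptic] [E₁.IsGloballyMinimal] [W.IsElliptic] [W.IsGloballyMinimal] (D₁ : Literature.NumberTheory.EllipticCurves.ModularForms.Gamma1ParametrizationData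 E₁ N), D₁.IsOptimal → WeierstrassCurve.IsIsogenous E₁ W → ∀ {L : PeriodPair}, Literature.NumberTheory.EllipticCurves.ModularForms.IsNeronLatticeOf (W.baseChange ℂ) L → ∀ {u : ℂ →+ (W.baseChange ℂ).toAffine.Point}, (u.ker : Set ℂ) = L.lattice → (∀ z ∉ L.lattice, ∃ h, u z = .some (L.weierstrassP z - (W.baseChange ℂ).b₂ / 12) ((L.derivWeierstrassP z - (W.baseChange ℂ).a₁ * (L.weierstrassP z - (W.baseChange ℂ).b₂ / 12) - (W.baseChange ℂ).a₃) / 2) h) → ∀ (j : (AlgebraicClosure ℚ) →ₐ[ℚ] ℂ), ∃ φ : WeierstrassCurve.Isogeny E₁ W, ∀ (P : E₁.geomPoints) (z : ℂ), (WeierstrassCurve.Affine.Point.map (W' := E₁) j : E₁.geomPoints →+ (E₁.baseChange ℂ).toAffine.Point) P = D₁.uniformize z → (WeierstrassCurve.Affine.Point.map (W' := W) j : W.geomPoints →+ (W.baseChange ℂ).toAffine.Point) (φ P) = u z) ∧ (∀ {N : ℕ} [NeZero N] {E₁ W : WeierstrassCurve ℚ} [E₁.IsElliptic] [E₁.IsGloballyMinimal]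 [W.IsElliptic] [W.IsGloballyMinimal] (D₁ : Literature.NumberTheory.EllipticCurves.ModularForms.Gamma1ParametrizationData E₁ N), D₁.IsOptimal → WeierstrassCurve.IsIsogenous E₁ W → E₁.faltingsHeight ≤ W.faltingsHeight)

/-- item stmt-BirchSwinnertonDyer-27552 · support · rank 407 · closed · proved by Summit.BirchSwinnertonDyer.BirchSwinnertonDyer.Theorems.TwistFamilyManinDescentCdtThm1.OrdinaryCornerManinResidual_proof (prover) · by planner
why it might fail: An optimal III@5 or II/IV@7 curve (e = p−1, pot. ordinary, E[p] reducible) with p | c in Edixhoven's case 1 (Λ̃ = δΛ): Raynaud e < p−1 fails by one, nothing in print excludes it; census blind to c > 1 (Cremona c = 1, N ≤ 5·10⁵).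
sources: EdixhovenManin1991, CesnaviciusNeururerSaha2023, GealyKlagsbrun2017, CremonaAlgorithms1997
[crux · DECLARED RESIDUAL of LINE 17 · GLUED NODE since LINE 18R (bsd-idea-3 g7, 2026-08-28)] The
ORDINARY half of the reducible Eisenstein corner at p ∈ {5,7}: Corner57 (stmt-26289) restricted to
the rows NOT covered by the supersingular transport T17 (i.e. everything except (5; v₅Δ_min ∈
{2,10})): potentially ordinary rows (5; III, III*: v ∈ {3,9}), (7; II, IV, IV*, II*: v ∈ {2,4,8,10})
plus vacuous off-table rows; conclusion p ∤ c for the X₀(N)-optimal curve. CURRENT SPLIT = LINE 18R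
`OrdinaryCornerOfSerreTateDepth` (stmt-27664, glue PROVED in HOME ideas/Sketch18R.lean): I9
`OrdinaryCornerOptimalSerreTateDeep` (stmt-27660, crux · instrument-born orientation law: the
optimal curve is Serre–Tate-deep, v₅(j−1728) ≥ 3 / v₇(j) ≥ 4, i.e. E[p]|I_p split with the rational
kernel étale-type; instrument I9 1064/1064 classes + 1242/1242 isogeny-edge jumps, 0 anomalies) →
K18a″ `OrdinaryCornerDeepEdixhovenDichotomy` (stmt-27661, crux · Edixhoven's dichotomy continued to
e(T) = p−1 by the two-prolongation dévissage: p | c ⇒ unstarred ∧ BOTTOM) → K18b″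
`OrdinaryCornerDeepUnstarredNotBottom` (stmt-27662, crux · C1-shape ¬case-1, the shared wall, count
once with C1 25939 / C2 26929) → `Ordinary -/
@[route_item "route-BirchSwinnertonDyer-TwistFamilyManinDescent", crux]
def OrdinaryCornerManinResidual : Prop :=
  Literature.NumberTheory.EllipticCurves.ModularForms.mazur_not_dvd_maninConstant_of_odd → Literature.NumberTheory.EllipticCurves.ModularForms.abbesUllmo_not_dvd_maninConstant_of_not_dvd_level → Literature.NumberTheory.EllipticCurves.ModularForms.cesnavicius_not_two_dvd_maninConstant_of_two_dvd_level → Literature.NumberTheory.EllipticCurves.ModularForms.exists_isNewformOf → ∀ (W : WeierstrassCurve ℚ) [W.IsElliptic] [W.IsGloballyMinimal] {N : ℕ} [NeZero N] (D : Literature.NumberTheory.EllipticCurves.ModularForms.ModularParametrizationData W N) (p : ℕ) (hp : p.Prime), (p = 5 ∨ p = 7) → ¬ ((p = 5 ∧ padicValInt 5 W.minimalDiscriminantInt ∈ ({4, 8} : Finset ℕ)) ∨ (p = 7 ∧ padicValInt 7 W.minimalDiscriminantInt ∈ ({3, 9} : Finset ℕ))) → ¬ (p = 5 ∧ padicValInt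 5 W.minimalDiscriminantInt ∈ ({2, 10} : Finset ℕ)) → p ^ 2 ∣ N → ¬ W.HasIrreducibleModPGaloisRep p → ¬ ((W.quadraticTwist (((-1 : ℤ) ^ (p / 2) * p : ℤ) : ℚ)).HasGoodReductionAt ((Rat.HeightOneSpectrum.primesEquiv (R := ℤ)).symm ⟨p, hp⟩) ∨ (W.quadraticTwist (((-1 : ℤ) ^ (p / 2) * p : ℤ) : ℚ)).HasMultiplicativeReductionAt ((Rat.HeightOneSpectrum.primesEquiv (R := ℤ)).symm ⟨p, hp⟩)) → (∀ z ∈ D.L.lattice, ∃ w ∈ Literature.NumberTheory.EllipticCurves.ModularForms.periodLattice D.f, z = D.c * w) → ¬ (p : ℤ) ∣ D.maninConstant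

-- `OrdinaryCornerManinResidual` holds: proved by `Summit.BirchSwinnertonDyer.BirchSwinnertonDyer.Theorems.TwistFamilyManinDescentCdtThm1.OrdinaryCornerManinResidual_proof` (its module imports this route file, so no `_holds` link can be stated here).

/-- item stmt-BirchSwinnertonDyer-27557 · aside · rank 408 · open · by planner
why it might fail: 'Figure 1' changes at p = 5,7 (genus-0 components of X0(p²)_U contract, Edixhoven–Parent 2021 §5) so Props 8–9 must be redone on X0(p²M)_U; at p = 5 cyclic 25-isogenies exist (X0(25) genus 0), so 'p ∤ deg α' fails and §4 gains the sub-case deg α = 25.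
sources: EdixhovenManin1991, Edixhoven1989Thesis, Raynaud1974, Tate1997FiniteFlatGroupSchemes, TateOort1970, arXiv:1802.06968
[crux · LINE 18 · K18a · NEW LOCAL LEVER «Tate–Oort/Raynaud boundary rigidity at e = p − 1» —
Edixhoven 1991 Props 7–9 + §4 continued to the ordinary reducible corner; size XL] On the
potentially ORDINARY corner rows (5; III/III*: v₅Δ_min ∈ {3,9}) and (7; II/IV/IV*/II*: v₇Δ_min ∈
{2,4,8,10}) — where one member of each χ_p*-twist pair has Serre–Tate exponent d = e(T) = p − 1
EXACTLY (T = W(F̄_p)[p^{1/d}], the field of good reduction in Prop 7), one past Raynaud's e < p − 1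
— restricted to WILD classes (E[p]|I_p NOT of exponent dividing p − 1 ⟺ I_T acts non-trivially on
E[p] ⟺ E[p]|I_p non-split): an X₀(N)-optimal curve with p | c is UNSTARRED (v < 6) and its newform
sits at the BOTTOM rung g·Λ(f⊗χ_p) = p·Λ(f) (Edixhoven's case 1; typed as in C1 stmt-25939).
MECHANISM (replaces the single use of e < p − 1, 1991 L646 «this explains the hypothesis p > 7»):
φ_*: ℰ_T[p] → H := its schematic image in 𝒥⁰_T is a morphism of finite flat PROLONGATIONS of V =
E[p]_T with ℰ_T[p] ≥ H (Tate/Raynaud, [corpus:cornell1997 p.204] Prop 4.2.1). In the proof of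
Raynaud's uniqueness theorem ([corpus:cornell1997 p.210] Thm 4.5.1) the inequality is e ≥ (p −
1)·v(a_i); at e = p − 1 this leaves v(a_i) ∈ {0,1 -/
@[route_item "route-BirchSwinnertonDyer-TwistFamilyManinDescent"]
def OrdinaryCornerWildEdixhovenDichotomy : Prop :=
  ∀ (W : WeierstrassCurve ℚ) [W.IsElliptic] [W.IsGloballyMinimal] (p : ℕ) [Fact p.Prime] [NeZero (W.conductorNorm ℤ)] (D : Literature.NumberTheory.EllipticCurves.ModularForms.ModularParametrizationData W (W.conductorNorm ℤ)) (hsq : p ^ 2 ∣ W.conductorNorm ℤ), ((p = 5 ∧ padicValInt 5 W.minimalDiscriminantInt ∈ ({3, 9} : Finset ℕ)) ∨ (p = 7 ∧ padicValInt 7 W.minimalDiscriminantInt ∈ ({2, 4, 8, 10} : Finset ℕ))) → ¬ W.HasIrreducibleModPGaloisRep p → (∀ z ∈ D.L.lattice, ∃ w ∈ Literature.NumberTheory.EllipticCurves.ModularForms.periodLattice D.f, z = D.c * w) → ¬ (∀ v : IsDedekindDomain.HeightOneSpectrum (NumberField.RingOfIntegers ℚ), ((p : ℕ) : NumberField.RingOfIntegers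 ℚ) ∈ v.asIdeal → ∀ 𝔓 ∈ v.primesAbove, ∀ σ ∈ 𝔓.inertia (Field.absoluteGaloisGroup ℚ), ∀ P : ↥(W.geomTorsion (p : ℤ)), (σ ^ (p - 1)) • P = P) → (p : ℤ) ∣ D.maninConstant → padicValInt p W.minimalDiscriminantInt < 6 ∧ ∀ (χ : DirichletCharacter ℂ p) (hχ : χ.IsQuadratic), χ.IsPrimitive → ∀ w ∈ Literature.NumberTheory.EllipticCurves.ModularForms.periodLattice (Literature.NumberTheory.EllipticCurves.ModularForms.charTwist (W.conductorNorm ℤ) (dvd_refl _) hsq hχ D.f), ∃ y ∈ Literature.NumberTheory.EllipticCurves.ModularForms.periodLattice D.f, gaussSum χ (ZMod.stdAddChar (N := p)) * w = (p : ℂ) * y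

/-- item stmt-BirchSwinnertonDyer-27558 · aside · rank 409 · open · by planner
why it might fail: Edixhoven's undecided case 1 (Λ̃ = δΛ) for an optimal unstarred ordinary curve — open at every p (C1 stmt-25939 = p ≥ 11); census j = −1 532/532 (N ≤ 5·10⁵) but blind beyond; one j = +1 pair refutes it.
sources: EdixhovenManin1991, GreenbergVatsal2000, Vatsal2005, Stevens1989, CremonaAlgorithms1997
[crux · LINE 18 · K18b · C1 `EisensteinOrdinaryTwistLatticeNotBottom` (stmt-25939, p ≥ 11) CONTINUED
to the unstarred wild ordinary corner rows (5; III: v = 3), (7; II: v = 2), (7; IV: v = 4)] For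
X₀(N)-optimal W on these rows with E[p] reducible and E[p]|I_p wild, and the quadratic primitive χ
mod p: NOT (g(χ)·Λ(f⊗χ) ⊆ p·Λ(f)) — the optimal unstarred curve is never in Edixhoven's case 1 (the
one configuration where his chain allows v_p(c) = 1). With K18a this closes the wild ordinary corner
(K18a: p | c ⇒ unstarred ∧ BOTTOM; K18b: unstarred ⇒ ¬BOTTOM). EVIDENCE I8 (HOME ideas/i8_N500k.out,
N ≤ 5·10⁵): at ALL 532 reducible ordinary corner pairs v_p(deg φ_unstarred-opt) = v_p(deg
φ_starred-opt) − 1, i.e. (Zagier at optimal data + Petersson isometry) covol Λ(f_unstarred) =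
p·covol Λ(f_starred): configuration TOP for the unstarred newform, never MIDDLE, never BOTTOM — the
same «strong is TOP» law recorded at p = 13 (C2 stmt-26929, kit j299881 44/44) and asserted at p ≥
11 by C1. MECHANISM candidates (open, shared with C1): (a) Stevens–Vatsal orientation: BOTTOM for f
would make the Eisenstein congruence of f̃ deeper than that of f, against the optimality of the
UNSTARRED member whose -/
@[route_item "route-BirchSwinnertonDyer-TwistFamilyManinDescent"]
def OrdinaryCornerUnstarredNotBottom : Prop :=
  ∀ (W : WeierstrassCurve ℚ) [W.IsElliptic] [W.IsGloballyMinimal] (p : ℕ) [Fact p.Prime] [NeZero (W.conductorNorm ℤ)] (D : Literature.NumberTheory.EllipticCurves.ModularForms.ModularParametrizationData W (W.conductorNorm ℤ)) (hsq : p ^ 2 ∣ W.conductorNorm ℤ), ((p = 5 ∧ padicValInt 5 W.minimalDiscriminantInt = 3) ∨ (p = 7 ∧ padicValInt 7 W.minimalDiscriminantInt ∈ ({2, 4} : Finset ℕ))) → ¬ W.HasIrreducibleModPGaloisRep p → (∀ z ∈ D.L.lattice, ∃ w ∈ Literature.NumberTheory.EllipticCurves.ModularForms.periodLattice D.f, z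 = D.c * w) → ¬ (∀ v : IsDedekindDomain.HeightOneSpectrum (NumberField.RingOfIntegers ℚ), ((p : ℕ) : NumberField.RingOfIntegers ℚ) ∈ v.asIdeal → ∀ 𝔓 ∈ v.primesAbove, ∀ σ ∈ 𝔓.inertia (Field.absoluteGaloisGroup ℚ), ∀ P : ↥(W.geomTorsion (p : ℤ)), (σ ^ (p - 1)) • P = P) → ∀ (χ : DirichletCharacter ℂ p) (hχ : χ.IsQuadratic), χ.IsPrimitive → ¬ (∀ w ∈ Literature.NumberTheory.EllipticCurves.ModularForms.periodLattice (Literature.NumberTheory.EllipticCurves.ModularForms.charTwist (W.conductorNorm ℤ) (dvd_refl _) hsq hχ D.f), ∃ y ∈ Literature.NumberTheory.EllipticCurves.ModularForms.periodLattice D.f, gaussSum χ (ZMod.stdAddChar (N := p)) * w = (p : ℂ) * y)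

/-- item stmt-BirchSwinnertonDyer-27559 · aside · rank 410 · closed · proved by Summit.BirchSwinnertonDyer.BirchSwinnertonDyer.Theorems.TwistFamilyManinDescentCdtThm1.OrdinaryCornerTameManinResidual_proof (prover) · by planner
why it might fail: A tame-split optimal (5;III)/(7;II,IV) curve with p | c: neither Raynaud (e < p−1) nor Tate–Oort rigidity controls ker(E_t[p] → J_t); density ≈ 1/p, decidable per curve (I8c), no lever.
sources: Raynaud1974, TateOort1970, EdixhovenManin1991
[crux · DECLARED RESIDUAL · LINE 18 · K18t] OrdinaryCornerManinResidual (stmt-27552) OFF the wild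
table rows: (i) the TAME-SPLIT ordinary corner classes — E[p]|I_p of exponent dividing p − 1 (I_T
trivial on E[p]); there BOTH Tate–Oort prolongations ℤ/p ⇝ μ_p live inside J₀(N)/O_T and K18a's
rigidity says nothing, Raynaud's e < p − 1 is genuinely needed — expected density ≈ 1/p of the
corner classes, DECIDABLE per curve (pari, instrument I8c), never forced by the isogeny graph (I8b:
optimal curve is an END vertex of every 25-chain, 0/754 middle); (ii) the vacuous rows of the
signature (additive W at p ∈ {5,7}, v_pΔ_min ∉ {2,3,4,8,9,10}, p*-twist additive: empty — I₀*/Iₙ*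
twist to I₀/Iₙ; bookkeeping via
`padicValInt_minimalDiscriminantInt_mem_of_addv_of_padicValRat_j_nonneg` + the pot-multiplicative
twist, provable now, folded here to keep the glue propositional). Why it might fail: a tame-split
optimal (5; III) or (7; II/IV) curve with p | c — the configuration where neither Raynaud nor
Tate–Oort controls ker(ℰ_t[p] → 𝒥_t); no lever beyond v(c) ≤ 1-type bounds. Sources: Raynaud1974
(3.3.6), TateOort1970, EdixhovenManin1991 Prop 7, Cremona ecdata. bears_on: stmt-27552 → stmt-26289
→ -/
@[route_item "route-BirchSwinnertonDyer-TwistFamilyManinDescent"]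
def OrdinaryCornerTameManinResidual : Prop :=
  Literature.NumberTheory.EllipticCurves.ModularForms.mazur_not_dvd_maninConstant_of_odd → Literature.NumberTheory.EllipticCurves.ModularForms.abbesUllmo_not_dvd_maninConstant_of_not_dvd_level → Literature.NumberTheory.EllipticCurves.ModularForms.cesnavicius_not_two_dvd_maninConstant_of_two_dvd_level → Literature.NumberTheory.EllipticCurves.ModularForms.exists_isNewformOf → ∀ (W : WeierstrassCurve ℚ) [W.IsElliptic] [W.IsGloballyMinimal] {N : ℕ} [NeZero N] (D : Literature.NumberTheory.EllipticCurves.ModularForms.ModularParametrizationData W N) (p : ℕ) (hp : p.Prime), (p = 5 ∨ p = 7) → ¬ ((p = 5 ∧ padicValInt 5 W.minimalDiscriminantInt ∈ ({4, 8} : Finset ℕ)) ∨ (p = 7 ∧ padicValInt 7 W.minimalDiscriminantInt ∈ ({3, 9} : Finset ℕ))) → ¬ (p = 5 ∧ padicValInt 5 W.minimalDiscriminantInt ∈ ({2, 10} : Finset ℕ)) → p ^ 2 ∣ N → ¬ W.HasIrreducibleModPGaloisRep p → ¬ ((W.quadraticTwist (((-1 : ℤ) ^ (p / 2) * p : ℤ)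 : ℚ)).HasGoodReductionAt ((Rat.HeightOneSpectrum.primesEquiv (R := ℤ)).symm ⟨p, hp⟩) ∨ (W.quadraticTwist (((-1 : ℤ) ^ (p / 2) * p : ℤ) : ℚ)).HasMultiplicativeReductionAt ((Rat.HeightOneSpectrum.primesEquiv (R := ℤ)).symm ⟨p, hp⟩)) → (∀ z ∈ D.L.lattice, ∃ w ∈ Literature.NumberTheory.EllipticCurves.ModularForms.periodLattice D.f, z = D.c * w) → ¬ (((p = 5 ∧ padicValInt 5 W.minimalDiscriminantInt ∈ ({3, 9} : Finset ℕ)) ∨ (p = 7 ∧ padicValInt 7 W.minimalDiscriminantInt ∈ ({2, 4, 8, 10} : Finset ℕ))) ∧ ¬ (∀ v : IsDedekindDomain.HeightOneSpectrum (NumberField.RingOfIntegers ℚ), ((p : ℕ) : NumberField.RingOfIntegers ℚ) ∈ v.asIdeal → ∀ 𝔓 ∈ v.primesAbove, ∀ σ ∈ 𝔓.inertia (Field.absoluteGaloisGroup ℚ), ∀ P : ↥(W.geomTorsion (p : ℤ)), (σ ^ (p - 1)) • P = P)) → ¬ (p : ℤ) ∣ D.maninConstant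

-- `OrdinaryCornerTameManinResidual` holds: proved by `Summit.BirchSwinnertonDyer.BirchSwinnertonDyer.Theorems.TwistFamilyManinDescentCdtThm1.OrdinaryCornerTameManinResidual_proof` (its module imports this route file, so no `_holds` link can be stated here).

/-- item stmt-BirchSwinnertonDyer-27660 · aside · rank 411 · open · by planner
why it might fail: I9 'the X₀-optimal curve of a reducible ordinary additive corner class is Serre–Tate deep': an optimal curve sitting at depth 1 of the p-isogeny graph on rows (5;3)/(7;2)/(7;4) refutes it; the étale-top law was checked only on 124 classes (N ≤ 4·10⁵).
sources: CremonaEcdata, EdixhovenManin1991 §2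
[crux] [crux · LINE 18R · I9 · INSTRUMENT-BORN ORIENTATION LAW (finite-model; size L)] At a
reducible potentially-ORDINARY additive prime p ∈ {5,7} (rows (5; III/III*), (7; II/IV/IV*/II*), p²
| N, E[p] reducible, p*-twist additive) the X₀(N)-optimal curve W is SERRE–TATE-DEEP: v₅(j(W) −
1728) ≥ 3, resp. v₇(j(W)) ≥ 4. DICTIONARY (HOME ideas/I9-serre-tate-depth.md; elementary deformation
theory, to be typed as a Literature lemma): with T = W(F̄_p)[p^{1/d}] (d = e(T) = p − 1 for the
III/III* resp. II/II* member), q = Serre–Tate parameter of the good model ℰ/O_T and m = v_T(q − 1):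
(1) E[p]|I_p is SPLIT (tame) ⟺ ℰ[p] ≅ μ_p × ℤ/p ⟺ q ∈ (O_T^×)^p ⟺ m ≥ p (p-th powers of 1-units at e
= p − 1 are exactly the 1-units of level ≥ p); (2) coarse moduli at the elliptic point j = 1728
(Aut/± acts by q ↦ q⁻¹) resp. j = 0: m = 2·v₅(j − 1728) resp. 2·v₇(j) (consistency: type III forces
v₅(j−1728) odd ⟺ m ≡ 2 mod 4 = the descent constraint ✓); (3) an étale-kernel p-isogeny lowers m by
p − 1, the canonical one raises it; (4) X₀(5): j − 1728 = (x²+22x+125)(x²+4x−1)²/x, X₀(7): j =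
(x²+13x+49)(x²+5x+1)³/x ⇒ every reducible pot-ordinary class at 5, 7 has a TAME branch (v(x) = 0)
and a WILD branch (v(x) = -/
@[route_item "route-BirchSwinnertonDyer-TwistFamilyManinDescent"]
def OrdinaryCornerOptimalSerreTateDeep : Prop :=
  ∀ (W : WeierstrassCurve ℚ) [W.IsElliptic] [W.IsGloballyMinimal] {N : ℕ} [NeZero N] (D : Literature.NumberTheory.EllipticCurves.ModularForms.ModularParametrizationData W N) (p : ℕ) (hp : p.Prime), ((p = 5 ∧ padicValInt 5 W.minimalDiscriminantInt ∈ ({3, 9} : Finset ℕ)) ∨ (p = 7 ∧ padicValInt 7 W.minimalDiscriminantInt ∈ ({2, 4, 8, 10} : Finset ℕ))) → p ^ 2 ∣ N → ¬ W.HasIrreducibleModPGaloisRep p → ¬ ((W.quadraticTwist (((-1 : ℤ) ^ (p / 2) * p : ℤ) : ℚ)).HasGoodReductionAt ((Rat.HeightOneSpectrum.primesEquiv (R := ℤ)).symm ⟨p, hp⟩) ∨ (W.quadraticTwist (((-1 : ℤ) ^ (p / 2) * p : ℤ) : ℚ)).HasMultiplicativeReductionAt ((Rat.HeightOneSpectrum.primesEquiv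 (R := ℤ)).symm ⟨p, hp⟩)) → (∀ z ∈ D.L.lattice, ∃ w ∈ Literature.NumberTheory.EllipticCurves.ModularForms.periodLattice D.f, z = D.c * w) → ((p = 5 → (3 : ℤ) ≤ padicValRat 5 (W.j - 1728)) ∧ (p = 7 → (4 : ℤ) ≤ padicValRat 7 W.j))

/-- item stmt-BirchSwinnertonDyer-27661 · aside · rank 412 · closed · proved by Summit.BirchSwinnertonDyer.BirchSwinnertonDyer.Theorems.TwistFamilyManinDescentCdtThm1.OrdinaryCornerDeepEdixhovenDichotomy_proof (prover) · by planner
why it might fail: K18a″ Edixhoven dichotomy on the Serre–Tate-deep ordinary corner: the wild (depth ≥ 2) rows may carry the TOP lattice without the Kummer-free hypothesis; Edixhoven Thm 3 is silent when p ∣ #Φ or the p-isogeny is étale-up.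
sources: EdixhovenManin1991 Thm 3, §4, DokchitserDokchitser2015 Thm 5.1
[crux · LINE 18R · K18a″ · XL · literature/referee reader item, NOT a Lean-prover item (V87/V91)] On
the ordinary corner rows, for an X₀(N)-optimal W with E[p] reducible, p*-twist additive and DEEP
(v₅(j−1728) ≥ 3 / v₇(j) ≥ 4 ⟺ ℰ[p] ≅ μ_p × ℤ/p SPLIT over O_T, T = W(𝔽̄_p)[p^{1/(p−1)}]): p | c ⇒
v_pΔ_min < 6 ∧ BOTTOM(χ) for every quadratic primitive χ mod p (Edixhoven's case 1 = C1-shape). (V91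
price 1) TYPED HYPOTHESIS = DEEP (split), NOT «Case A» (étale factor = closure of the rational
kernel Φ): DEEP ⇏ Case A (tame Case-B partners exist, depth pattern (5,3)); the census certifies
Case A for optimal curves (optimal = deepest 1064/1064; typed sharpening I9♯
`OrdinaryCornerOptimalDeeperThanNeighbours` elaborates in HOME ideas/Sketch18S-I9sharp.lean, not
filed) but the item CLAIMS the dichotomy for every deep optimal curve. CASE-B DISPATCH: the e = p−1
dévissage (only the bottom étale layer of ℰ_T[p^k] can drop inside 𝒥⁰_T, Tate 1997 4.2.1(b)/4.5.1),
Edixhoven's G = ℰ̃_t ∩ ⊕𝔾ₐ step and his Props 8–9 / §4 TWIST-pair bookkeeping are local resp.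
twist-based and never use ℚ-rationality of the droppable étale line, so G ∈ {0, étale ℤ/p, ℤ/p²} and
everything downstream hold verbatim in Cas -/
@[route_item "route-BirchSwinnertonDyer-TwistFamilyManinDescent"]
def OrdinaryCornerDeepEdixhovenDichotomy : Prop :=
  ∀ (W : WeierstrassCurve ℚ) [W.IsElliptic] [W.IsGloballyMinimal] (p : ℕ) [Fact p.Prime] [NeZero (W.conductorNorm ℤ)] (D : Literature.NumberTheory.EllipticCurves.ModularForms.ModularParametrizationData W (W.conductorNorm ℤ)) (hsq : p ^ 2 ∣ W.conductorNorm ℤ), ((p = 5 ∧ padicValInt 5 W.minimalDiscriminantInt ∈ ({3, 9} : Finset ℕ)) ∨ (p = 7 ∧ padicValInt 7 W.minimalDiscriminantInt ∈ ({2, 4, 8, 10} : Finset ℕ))) → ¬ W.HasIrreducibleModPGaloisRep p → ¬ ((W.quadraticTwist (((-1 : ℤ) ^ (p / 2) * p : ℤ) : ℚ)).HasGoodReductionAt ((Rat.HeightOneSpectrum.primesEquiv (R := ℤ)).symm ⟨p, Fact.out⟩) ∨ (W.quadraticTwist (((-1 : ℤ) ^ (p / 2) * p : ℤ) : ℚ)).HasMultiplicativeReductionAt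 ((Rat.HeightOneSpectrum.primesEquiv (R := ℤ)).symm ⟨p, Fact.out⟩)) → (∀ z ∈ D.L.lattice, ∃ w ∈ Literature.NumberTheory.EllipticCurves.ModularForms.periodLattice D.f, z = D.c * w) → ((p = 5 → (3 : ℤ) ≤ padicValRat 5 (W.j - 1728)) ∧ (p = 7 → (4 : ℤ) ≤ padicValRat 7 W.j)) → (p : ℤ) ∣ D.maninConstant → padicValInt p W.minimalDiscriminantInt < 6 ∧ ∀ (χ : DirichletCharacter ℂ p) (hχ : χ.IsQuadratic), χ.IsPrimitive → ∀ w ∈ Literature.NumberTheory.EllipticCurves.ModularForms.periodLattice (Literature.NumberTheory.EllipticCurves.ModularForms.charTwist (W.conductorNorm ℤ) (dvd_refl _) hsq hχ D.f), ∃ y ∈ Literature.NumberTheory.EllipticCurves.ModularForms.periodLattice D.f, gaussSum χ (ZMod.stdAddChar (N := p)) * w = (p : ℂ) * y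

-- `OrdinaryCornerDeepEdixhovenDichotomy` holds: proved by `Summit.BirchSwinnertonDyer.BirchSwinnertonDyer.Theorems.TwistFamilyManinDescentCdtThm1.OrdinaryCornerDeepEdixhovenDichotomy_proof` (its module imports this route file, so no `_holds` link can be stated here).

/-- item stmt-BirchSwinnertonDyer-27662 · aside · rank 413 · open · by planner
why it might fail: K18b″ ⟺ (p638420) horocyclic witnesses Σ(−1)^i C(k,i){∞, A/C + i/p} ∉ pΛ_f on the deep unstarred ordinary rows (5;3),(7;2),(7;4), W[p] reducible: a row where every alternating horocyclic sum is p-divisible (BOTTOM orientation) refutes it; no c-blind instrument below N = 4·10⁵ separates.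
sources: EdixhovenManin1991 §4, MazurTateTeitelbaum1986Invent §I.8, Shimura1971 Prop. 3.64
[crux] [crux · LINE 18R · K18b″ · C1-shape ¬case-1 on the unstarred ordinary corner rows (5; III: v
= 3), (7; II: v = 2), (7; IV: v = 4) for DEEP optimal curves; SUPERSEDES K18b stmt-27558 (WILD
hypothesis void by I9)] For X₀(N)-optimal W on these rows with E[p] reducible, p*-twist additive and
Serre–Tate-deep, and every quadratic primitive χ mod p: NOT (g(χ)·Λ(f⊗χ) ⊆ p·Λ(f)). Honest reading:
given twist-of-optimal = optimal (I8: 532/532) and Zagier + the Petersson isometry, BOTTOM(f) ⟺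
v_p(c) = v_p(c̃) + 1 and TOP(f) ⟺ v_p(c) = v_p(c̃) — the census configuration (TOP, 532/532) is
therefore EQUIVALENT to Cremona's c = c̃ = 1 on these pairs, a dictionary check, not independent
evidence; the item is the shared open heart of the ordinary Eisenstein regime (C1 stmt-25939 is its
p ≥ 11 version) stated where the new DEEP/Case-A structure is available as an extra handle: Case A
says the optimal curve's kernel Φ is the ÉTALE factor, i.e. (Stevens–Vatsal orientation) the
Eisenstein congruence of f is 'at the étale cusp side', which is the configuration in which
Greenberg–Vatsal/Vatsal prove the unstarred member's canonical periods are the lattice periods (μ =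
0 side) — mechanism candidate ( -/
@[route_item "route-BirchSwinnertonDyer-TwistFamilyManinDescent"]
def OrdinaryCornerDeepUnstarredNotBottom : Prop :=
  ∀ (W : WeierstrassCurve ℚ) [W.IsElliptic] [W.IsGloballyMinimal] (p : ℕ) [Fact p.Prime] [NeZero (W.conductorNorm ℤ)] (D : Literature.NumberTheory.EllipticCurves.ModularForms.ModularParametrizationData W (W.conductorNorm ℤ)) (hsq : p ^ 2 ∣ W.conductorNorm ℤ), ((p = 5 ∧ padicValInt 5 W.minimalDiscriminantInt = 3) ∨ (p = 7 ∧ padicValInt 7 W.minimalDiscriminantInt ∈ ({2, 4} : Finset ℕ))) → ¬ W.HasIrreducibleModPGaloisRep p → ¬ ((W.quadraticTwist (((-1 : ℤ) ^ (p / 2) * p : ℤ) : ℚ)).HasGoodReductionAt ((Rat.HeightOneSpectrum.primesEquiv (R := ℤ)).symm ⟨p, Fact.out⟩) ∨ (W.quadraticTwist (((-1 : ℤ) ^ (p / 2) * p : ℤ) : ℚ)).HasMultiplicativeReductionAt ((Rat.HeightOneSpectrum.primesEquiv (R := ℤ)).symm ⟨p, Fact.out⟩)) → (∀ z ∈ D.L.lattice,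 ∃ w ∈ Literature.NumberTheory.EllipticCurves.ModularForms.periodLattice D.f, z = D.c * w) → ((p = 5 → (3 : ℤ) ≤ padicValRat 5 (W.j - 1728)) ∧ (p = 7 → (4 : ℤ) ≤ padicValRat 7 W.j)) → ∀ (χ : DirichletCharacter ℂ p) (hχ : χ.IsQuadratic), χ.IsPrimitive → ¬ (∀ w ∈ Literature.NumberTheory.EllipticCurves.ModularForms.periodLattice (Literature.NumberTheory.EllipticCurves.ModularForms.charTwist (W.conductorNorm ℤ) (dvd_refl _) hsq hχ D.f), ∃ y ∈ Literature.NumberTheory.EllipticCurves.ModularForms.periodLattice D.f, gaussSum χ (ZMod.stdAddChar (N := p)) * w = (p : ℂ) * y)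

/-- item stmt-BirchSwinnertonDyer-27071 · support · rank 4050 · closed · proved by Summit.BirchSwinnertonDyer.BirchSwinnertonDyer.Theorems.TwistFamilyManinDescentCdtThm1.SupersingularUnstarredStrongManinUnit_proof (prover) · by planner
why it might fail: Print-extension of Edixhoven's thesis Thm 4.3.2 + Lemma 4.6.4 + Prop 4.2.4 to (p,d) ∈ {(5,3),(7,4)}: a third hidden use of p > 7 in §4 (beyond U1–U8 of the referee read), or the genus-2 horizontal components at p = 5 breaking the component-map separability, kills it.
sources: Edixhoven1989Thesis, EdixhovenManin1991, Raynaud1974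
[crux · LINE 15 · K15b · print-extension] Ray57 (EisensteinRaynaudRegimeManinUnit, stmt-26325)
RESTRICTED TO ITS UNSTARRED ROWS (5; IV, v₅Δ_min = 4) and (7; III, v₇Δ_min = 3): p ∤ c for the
lattice-optimal (= X₀-optimal) curve. Mechanism = Edixhoven's thesis (1989) Thm 4.3.2 + Lemma 4.6.4
+ Prop 4.2.4 (= 1991 Prop 7): stable X₀(p²M) over T of degree d = e ∈ {3,4} < p − 1, Raynaud, SS ⇒
kernel ⊂ α_p, component maps separable ⇒ p ∤ c for EVERY strong curve with unstarred pot.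
supersingular reduction — printed for p > 7; the two uses of p (Raynaud d < p − 1; component
multiplicities of the stable fibre prime to p) hold at (p,d) ∈ {(5,3),(7,4)} (evidence
Ray57-referee-read.md, U1–U8). Bonus from LINE 15 §1: on these rows no class member contains μ_p or
ℤ/p, so any hidden 'p > 7 ⇒ no rational p-torsion' use is automatic. Why it might fail: a third,
unlisted use of p > 7 in thesis §4.2–4.6 at d ∈ {3,4} (e.g. a genus/degree bound on the
supersingular components at p = 5). Sources: Edixhoven1989Thesis (Thm 4.3.2, Lemma 4.6.4, Prop
4.2.4), EdixhovenManin1991 (Prop 7, Thm 3), Raynaud1974. bears_on: Ray57 stmt-26325 via glue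
RaynaudRegimeOfOrientation → R stmt-25138 → X₅ stmt-22969 → ManinCon -/
@[route_item "route-BirchSwinnertonDyer-TwistFamilyManinDescent", crux]
def SupersingularUnstarredStrongManinUnit : Prop :=
  Literature.NumberTheory.EllipticCurves.ModularForms.mazur_not_dvd_maninConstant_of_odd → Literature.NumberTheory.EllipticCurves.ModularForms.abbesUllmo_not_dvd_maninConstant_of_not_dvd_level → Literature.NumberTheory.EllipticCurves.ModularForms.cesnavicius_not_two_dvd_maninConstant_of_two_dvd_level → Literature.NumberTheory.EllipticCurves.ModularForms.exists_isNewformOf → ∀ (W : WeierstrassCurve ℚ) [W.IsElliptic] [W.IsGloballyMinimal] {N : ℕ} [NeZero N] (D : Literature.NumberTheory.EllipticCurves.ModularForms.ModularParametrizationData W N) (p : ℕ) (hp : p.Prime), ((p = 5 ∧ padicValInt 5 W.minimalDiscriminantInt = 4) ∨ (p = 7 ∧ padicValInt 7 W.minimalDiscriminantInt = 3)) → p ^ 2 ∣ N → ¬ W.HasIrreducibleModPGaloisRep p → ¬ ((W.quadraticTwist (((-1 : ℤ) ^ (p / 2) * p : ℤ) : ℚ)).HasGoodReductionAt ((Rat.HeightOneSpectrum.primesEquiv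 (R := ℤ)).symm ⟨p, hp⟩) ∨ (W.quadraticTwist (((-1 : ℤ) ^ (p / 2) * p : ℤ) : ℚ)).HasMultiplicativeReductionAt ((Rat.HeightOneSpectrum.primesEquiv (R := ℤ)).symm ⟨p, hp⟩)) → (∀ z ∈ D.L.lattice, ∃ w ∈ Literature.NumberTheory.EllipticCurves.ModularForms.periodLattice D.f, z = D.c * w) → ¬ (p : ℤ) ∣ D.maninConstant

-- `SupersingularUnstarredStrongManinUnit` holds: proved by `Summit.BirchSwinnertonDyer.BirchSwinnertonDyer.Theorems.TwistFamilyManinDescentCdtThm1.SupersingularUnstarredStrongManinUnit_proof` (its module imports this route file, so no `_holds` link can be stated here).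

/-- item stmt-BirchSwinnertonDyer-27072 · support · rank 4051 · open · by planner
why it might fail: It is the p-part of Stevens' conjecture (E₁ = E_min) on these classes: ONE X₀-optimal curve of type IV* at 5 or III* at 7 with reducible E[p] refutes it (census 0/25 N ≤ 6000, 0/31 ecdata; kit j304536 extends); the engine needs S3* (Hida 4.3 without (opl)), outside print.
sources: Stevens1989Invent, Vatsal2005, SilvermanAEC2009, Serre1972
[support · split/assembly node since LINE 16 · beyond print · «SS-Stevens at p ∈ {5,7}»] KILL/ORPHAN
CRITERION (critic V71/N74): K15a and its engine S16b (stmt-27296) have ONE written mechanism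
(twisted Vatsal through S3*); if S3* dies they stay CONJECTURES with certified instrument evidence
and NO line — no prover before B4's verbatim read; S16a (stmt-27295) and the glues are prover-grade
now. STATEMENT: on Ray57's Raynaud rows (p = 5, v₅Δ_min ∈ {4,8}; p = 7, v₇Δ_min ∈ {3,9}; p² ∣ N;
E[p] reducible; p*-twist additive) a lattice-optimal globally minimal W is UNSTARRED (v_pΔ_min < 6)
— the starred rows of Ray57 are vacuous. REDUCTION (LINE 16; critic V79 PASS-WITH-PRICE): K15a ⇐
modularity ∧ S16b ALONE — S16a (stmt-27295, no ℚ_p-rational p-torsion in the class) CLOSED·proved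
p624109 and the glue StrongIsUnstarredOfKummerFree (stmt-27338) CLOSED·proved p624309 (prover
bsd-line-ttd-p1 g7, 2026-08-28). INSTRUMENTS: I6 ecdata N < 5·10⁵ (HOME ideas/I6-ecdata-census.md):
reducible SS-Raynaud classes always contain both twins and the optimal curve is the UNSTARRED twin
in 947/947 (863 optimality-certified; 0 kill rows), all 2118 members Kummer-free (kit j305802); kit
boxes j304536/j304646/ -/
@[route_item "route-BirchSwinnertonDyer-TwistFamilyManinDescent", crux]
def SupersingularStrongIsUnstarred : Prop :=
  ∀ (W : WeierstrassCurve ℚ) [W.IsElliptic] [W.IsGloballyMinimal] {N : ℕ} [NeZero N] (D : Literature.NumberTheory.EllipticCurves.ModularForms.ModularParametrizationData W N) (p : ℕ) (hp : p.Prime), ((p = 5 ∧ padicValInt 5 W.minimalDiscriminantInt ∈ ({4, 8} : Finset ℕ)) ∨ (p = 7 ∧ padicValInt 7 W.minimalDiscriminantInt ∈ ({3, 9} : Finset ℕ))) → p ^ 2 ∣ N → ¬ W.HasIrreducibleModPGaloisRep p → ¬ ((W.quadraticTwist (((-1 : ℤ) ^ (p / 2) * p : ℤ) : ℚ)).HasGoodReductionAt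 ((Rat.HeightOneSpectrum.primesEquiv (R := ℤ)).symm ⟨p, hp⟩) ∨ (W.quadraticTwist (((-1 : ℤ) ^ (p / 2) * p : ℤ) : ℚ)).HasMultiplicativeReductionAt ((Rat.HeightOneSpectrum.primesEquiv (R := ℤ)).symm ⟨p, hp⟩)) → (∀ z ∈ D.L.lattice, ∃ w ∈ Literature.NumberTheory.EllipticCurves.ModularForms.periodLattice D.f, z = D.c * w) → padicValInt p W.minimalDiscriminantInt < 6

/-- item stmt-BirchSwinnertonDyer-27296 · aside · rank 4052 · open · by planner
why it might fail: Twisted-Vatsal engine outside print: steps S3*/S4 (unramifiedness + Ihara at ℓ = p with p² ∣ N; Vatsal 2005 §4 is prime-to-p level) may fail at additive level; one SS-Raynaud class with a STARRED X₀-optimal curve (instrument I1, 0/17 so far) refutes it outright.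
sources: Vatsal2005, Stevens1989Invent, LingOesterle1991ShimuraSubgroup, EdixhovenManin1991, ByeonYhee2013, SilvermanAEC2009
[crux · LINE 16 · S16b · beyond print — the ENGINE of K15a with exactly the hypothesis it consumes]
K15a (SupersingularStrongIsUnstarred, stmt-27072) restricted to KUMMER-FREE classes: on the Raynaud
rows with p² ∣ N, E[p] reducible, p*-twist still additive, if no curve ℚ-isogenous to W has a
ℚ_p-rational point of order p, then a lattice-optimal (= X₀(N)-optimal) W is UNSTARRED (v_pΔ_min <
6). Plan (LINE 14/15 engine): were the starred member E* optimal, the kernel C of E* → E (unstarred)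
gives by optimality an irreducible C^D-torsor over X₀(N) (S1), locally trivial at p (S2, from the
Kummer-free/formal-group input), unramified over the other bad fibres (S3* = shared frontier input,
critic's K1, referee order B3 → B2′ → B1), hence by Vatsal–Ihara from the Shimura subgroup Σ (S4); Σ
is μ-type so χ_C = ω globally and E*[p]/C ≅ ℤ/p is a RATIONAL point of order p on E — contradicting
Kummer-freeness (S5″; the only place characters enter). Why it might fail: S3*/S4 at ℓ = p with p² ∣
N (Ihara-type lemma at additive level; Vatsal 2005 §4 is prime-to-p level) — XL. Novel vs listed
items: EF57/TTD Kummer-corner items (stmt-23883/23884, TTD 282/304) are the complementary cell (e ∈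
{p−1, p+1 -/
@[route_item "route-BirchSwinnertonDyer-TwistFamilyManinDescent", crux]
def SupersingularKummerFreeStrongIsUnstarred : Prop :=
  ∀ (W : WeierstrassCurve ℚ) [W.IsElliptic] [W.IsGloballyMinimal] {N : ℕ} [NeZero N] (D : Literature.NumberTheory.EllipticCurves.ModularForms.ModularParametrizationData W N) (p : ℕ) [hp : Fact p.Prime], ((p = 5 ∧ padicValInt 5 W.minimalDiscriminantInt ∈ ({4, 8} : Finset ℕ)) ∨ (p = 7 ∧ padicValInt 7 W.minimalDiscriminantInt ∈ ({3, 9} : Finset ℕ))) → p ^ 2 ∣ N → ¬ W.HasIrreducibleModPGaloisRep p → ¬ ((W.quadraticTwist (((-1 : ℤ) ^ (p / 2) * p : ℤ) : ℚ)).HasGoodReductionAt ((Rat.HeightOneSpectrum.primesEquiv (R := ℤ)).symm ⟨p, hp.out⟩) ∨ (W.quadraticTwist (((-1 : ℤ) ^ (p / 2) * p : ℤ) : ℚ)).HasMultiplicativeReductionAt ((Rat.HeightOneSpectrum.primesEquiv (R := ℤ)).symm ⟨p, hp.out⟩)) → (∀ (W' : WeierstrassCurve ℚ) [W'.IsElliptic],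 WeierstrassCurve.IsIsogenous W W' → ¬ ∃ P : (W'.baseChange ℚ_[p]).toAffine.Point, p • P = 0 ∧ P ≠ 0) → (∀ z ∈ D.L.lattice, ∃ w ∈ Literature.NumberTheory.EllipticCurves.ModularForms.periodLattice D.f, z = D.c * w) → padicValInt p W.minimalDiscriminantInt < 6

/-- item stmt-BirchSwinnertonDyer-27096 · support · rank 4059 · closed · proved by Summit.BirchSwinnertonDyer.BirchSwinnertonDyer.Theorems.TwistFamilyManinDescent.raynaudRegimeOfOrientation_proof (prover) · by planner
[support · LINE 15 · G15 · glue, PROVED in the planner's Sketch15.lean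
(raynaudRegimeOfOrientation_proof, lean check rc 0, 0 sorries)] Ray57 from its two LINE-15 pieces:
SupersingularStrongIsUnstarred (K15a: optimal ⇒ v_pΔ_min < 6 on Ray57 rows) →
SupersingularUnstarredStrongManinUnit (K15b: Ray57 on the rows v = 4 / v = 3) →
EisensteinRaynaudRegimeManinUnit. Proof: dispatch on the row predicate; a starred row (v ∈ {8,9})
contradicts K15a's bound, an unstarred row is K15b (intro …; rcases hrow with ⟨rfl, h5⟩ | ⟨rfl, h7⟩;
simp only [Finset.mem_insert, Finset.mem_singleton] at h5; omega). A prover lands it verbatim in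
Theorems/ (one file, ~15 lines). bears_on: Ray57 stmt-26325. No summit is proved by this line. -/
@[route_item "route-BirchSwinnertonDyer-TwistFamilyManinDescent"]
def RaynaudRegimeOfOrientation : Prop :=
  SupersingularStrongIsUnstarred → SupersingularUnstarredStrongManinUnit → EisensteinRaynaudRegimeManinUnit

-- `RaynaudRegimeOfOrientation` holds: proved by `Summit.BirchSwinnertonDyer.BirchSwinnertonDyer.Theorems.TwistFamilyManinDescent.raynaudRegimeOfOrientation_proof` (its module imports this route file, so no `_holds` link can be stated here).

/-- item stmt-BirchSwinnertonDyer-27295 · support · rank 4060 · closed · proved by Summit.BirchSwinnertonDyer.BirchSwinnertonDyer.Theorems.TwistFamilyManinDescent.raynaudRegimeClassNoLocalPTorsion_proof (prover) · by planner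
sources: SilvermanAEC2009, SerreTate1968GoodReduction, Serre1972, DokchitserDokchitser2015LocalInvariants
[support · LINE 16 · S16a · PROVABLE NOW (sizes S–M ×3) — the typed lever of LINE 15] On the Raynaud
rows (p, v_pΔ_min) ∈ {(5;4),(5;8),(7;3),(7;9)} (Kodaira IV/IV* at 5, III/III* at 7), W additive at p
and its p*-twist neither good nor multiplicative (potentially good, e = 12/gcd(12,v) ∈ {3,4} < p −
1, SUPERSINGULAR: j̃ = 0 at 5, 1728 at 7): NO curve ℚ-isogenous to W has a ℚ_p-rational point of
order p. Proof: e, potential goodness and supersingularity are isogeny invariants (Serre–Tate;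
Dokchitser–Dokchitser 2015 Table 1 / tree dokchitser_padicValInt_… for the v-sets); over K =
ℚ_p(p^{1/e}) good supersingular reduction puts W'(K)[p] inside the formal group Ê(𝔪_K), which has no
p-torsion since v_K(p) = e < p − 1 (Silverman AEC Thm IV.6.1: v(x) ≤ v(p)/(p−1) < 1). This is
exactly what the twisted-Vatsal engine of K15a consumes (S5″: no rational p-torsion in the class;
S2: same inequality over K^{nr}); it needs no reducibility and no character bookkeeping.
Multiplicative W are correctly excluded (Tate curves carry μ_p; the class of I₄@5 contains I₂₀ with
ℚ₅-rational 5-torsion). Instrument I5 (kit j304966 line16-wide57.gp, HOME ideas/): #x(E(ℚ_p)[p]) for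
every member of every reducible -/
@[route_item "route-BirchSwinnertonDyer-TwistFamilyManinDescent"]
def RaynaudRegimeClassNoLocalPTorsion : Prop :=
  ∀ (W : WeierstrassCurve ℚ) [W.IsElliptic] [W.IsGloballyMinimal] (p : ℕ) [hp : Fact p.Prime], ((p = 5 ∧ padicValInt 5 W.minimalDiscriminantInt ∈ ({4, 8} : Finset ℕ)) ∨ (p = 7 ∧ padicValInt 7 W.minimalDiscriminantInt ∈ ({3, 9} : Finset ℕ))) → Literature.NumberTheory.EllipticCurves.Rank1Residual.Addv W p → ¬ ((W.quadraticTwist (((-1 : ℤ) ^ (p / 2) * p : ℤ) : ℚ)).HasGoodReductionAt ((Rat.HeightOneSpectrum.primesEquiv (R := ℤ)).symm ⟨p, hp.out⟩) ∨ (W.quadraticTwist (((-1 : ℤ) ^ (p / 2) * p : ℤ) : ℚ)).HasMultiplicativeReductionAt ((Rat.HeightOneSpectrum.primesEquiv (R := ℤ)).symm ⟨p, hp.out⟩)) → ∀ (W' : WeierstrassCurve ℚ) [W'.IsElliptic], WeierstrassCurve.IsIsogenous W W' → ¬ ∃ P : (W'.baseChange ℚ_[p]).toAffine.Point, p • P =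 0 ∧ P ≠ 0

-- `RaynaudRegimeClassNoLocalPTorsion` holds: proved by `Summit.BirchSwinnertonDyer.BirchSwinnertonDyer.Theorems.TwistFamilyManinDescent.raynaudRegimeClassNoLocalPTorsion_proof` (its module imports this route file, so no `_holds` link can be stated here).

/-- item stmt-BirchSwinnertonDyer-27338 · support · rank 4061 · closed · proved by Summit.BirchSwinnertonDyer.BirchSwinnertonDyer.Theorems.TwistFamilyManinDescent.strongIsUnstarredOfKummerFree_proof (prover) · by planner
[support · LINE 16 glue · PROVED in HOME ideas/Sketch16.lean (glue16_proof, lean check rc 0, 0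
sorries)] modularity (exists_isNewformOf = Ray57's own antecedent h₄) →
RaynaudRegimeClassNoLocalPTorsion (S16a) → SupersingularKummerFreeStrongIsUnstarred (S16b) →
SupersingularStrongIsUnstarred (K15a). The only work is additivity: level = conductor
(IsNewformOf.level_eq_conductorNorm_of_exists_isNewformOf) and p² ∣ N_E ⇔ additive
(natGenerator_sq_dvd_conductorNorm_iff), packaged as addv_of_sq_dvd_level in the Sketch. Cone: Ray57
h₁…h₄ = RaynaudRegimeOfOrientation (this h₄ S16a S16b) K15b h₁…h₄ — no free fact enters. Sources:
Carayol1986, DiamondShurman2005 (Thm 8.8.1), SilvermanAEC2009. No summit is proved by this line. -/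
@[route_item "route-BirchSwinnertonDyer-TwistFamilyManinDescent"]
def StrongIsUnstarredOfKummerFree : Prop :=
  Literature.NumberTheory.EllipticCurves.ModularForms.exists_isNewformOf → RaynaudRegimeClassNoLocalPTorsion → SupersingularKummerFreeStrongIsUnstarred → SupersingularStrongIsUnstarred

-- `StrongIsUnstarredOfKummerFree` holds: proved by `Summit.BirchSwinnertonDyer.BirchSwinnertonDyer.Theorems.TwistFamilyManinDescent.strongIsUnstarredOfKummerFree_proof` (its module imports this route file, so no `_holds` link can be stated here).

/-- item stmt-BirchSwinnertonDyer-27551 · support · rank 4063 · closed · proved by Summit.BirchSwinnertonDyer.BirchSwinnertonDyer.Theorems.supersingularCornerTwistTransport_proof (prover) · by planner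
[support · LINE 17 · T17 · PROVABLE NOW (size L) — «SS-corner twist transport at 5»] On the
supersingular corner rows of Corner57 = EisensteinCornerManinResidual (stmt-26289) — p = 5,
v₅Δ_min(W) ∈ {2,10} (Kodaira II/II*, e = 6 ∤ p−1, potentially supersingular), E[5] reducible,
5*-twist additive — the X₀(N)-optimal W has 5 ∤ c, GRANTED the two Raynaud-row items K15a
`SupersingularStrongIsUnstarred` (stmt-27072) and Ray57 `EisensteinRaynaudRegimeManinUnit`
(stmt-26325) on the 5*-TWISTED class (Kodaira IV/IV*, e = 3 < p−1, where Edixhoven–Raynaud work).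
NEW LEVER (no stable/semistable model of the II-class is touched — d = 6 > p−1 becomes irrelevant):
Edixhoven's §4 degree identity read 5-adically ACROSS the twist pair, every ingredient already a
tree theorem: (1) `Summit.BirchSwinnertonDyer.Rank1Residual.Additive.padicVal_twist_identity` (p ≥
5, V unstarred additive pot-good, W♭ = minimal model of V⊗p*, ANY conductor-level data): v(deg D♭) +
2v(c(D)) = v(deg D) + 2v(c(D♭)) + 1; (2) Zagier `zagier_degree_formula_of_cosetReps` at the two
OPTIMAL data (Λ_E = c·Λ(f) ⇒ deg = 4π²(f,f)/covol Λ(f), free of c); (3) Petersson isometry ‖f⊗χ‖ =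
‖f‖ at equal level (Rank1Residual/O5 CharTwistPrime -/
@[route_item "route-BirchSwinnertonDyer-TwistFamilyManinDescent"]
def SupersingularCornerTwistTransport : Prop :=
  SupersingularStrongIsUnstarred → EisensteinRaynaudRegimeManinUnit → Literature.NumberTheory.EllipticCurves.ModularForms.mazur_not_dvd_maninConstant_of_odd → Literature.NumberTheory.EllipticCurves.ModularForms.abbesUllmo_not_dvd_maninConstant_of_not_dvd_level → Literature.NumberTheory.EllipticCurves.ModularForms.cesnavicius_not_two_dvd_maninConstant_of_two_dvd_level → Literature.NumberTheory.EllipticCurves.ModularForms.exists_isNewformOf → ∀ (W : WeierstrassCurve ℚ) [W.IsElliptic] [W.IsGloballyMinimal] {N : ℕ} [NeZero N] (D : Literature.NumberTheory.EllipticCurves.ModularForms.ModularParametrizationData W N) (p : ℕ) (hp : p.Prime), (p = 5 ∧ padicValInt 5 W.minimalDiscriminantInt ∈ ({2, 10} : Finset ℕ)) → p ^ 2 ∣ N → ¬ W.HasIrreducibleModPGaloisRep p → ¬ ((W.quadraticTwist (((-1 : ℤ) ^ (p / 2) * p : ℤ) : ℚ)).HasGoodReductionAt ((Rat.HeightOneSpectrum.primesEquiv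 (R := ℤ)).symm ⟨p, hp⟩) ∨ (W.quadraticTwist (((-1 : ℤ) ^ (p / 2) * p : ℤ) : ℚ)).HasMultiplicativeReductionAt ((Rat.HeightOneSpectrum.primesEquiv (R := ℤ)).symm ⟨p, hp⟩)) → (∀ z ∈ D.L.lattice, ∃ w ∈ Literature.NumberTheory.EllipticCurves.ModularForms.periodLattice D.f, z = D.c * w) → ¬ (p : ℤ) ∣ D.maninConstant

-- `SupersingularCornerTwistTransport` holds: proved by `Summit.BirchSwinnertonDyer.BirchSwinnertonDyer.Theorems.supersingularCornerTwistTransport_proof` (its module imports this route file, so no `_holds` link can be stated here).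

/-- item stmt-BirchSwinnertonDyer-27553 · support · rank 4064 · closed · proved by Summit.BirchSwinnertonDyer.BirchSwinnertonDyer.Theorems.TwistFamilyManinDescent.cornerResidualOfSupersingularTransport_proof (prover) · by planner
[support · glue · LINE 17 · PROVED in HOME ideas/Sketch17.lean
(`cornerResidualOfSupersingularTransport_proof`, lean check rc 0, 0 sorries: row dispatch on (p = 5
∧ v₅Δ_min ∈ {2,10}))] SupersingularCornerTwistTransport (T17) → OrdinaryCornerManinResidual →
SupersingularStrongIsUnstarred (K15a stmt-27072) → EisensteinRaynaudRegimeManinUnit (Ray57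
stmt-26325) → EisensteinCornerManinResidual (Corner57 stmt-26289, consumed by the route glue
EisensteinResidualOfTrichotomy stmt-25945). After this glue the open content of Corner57 is exactly
OrdinaryCornerManinResidual ∪ {K15a, Ray57}: the SS corner at 5 (771 of the 1303 reducible corner
classes with N ≤ 5·10⁵) rides on the Raynaud-row items. No free fact enters (T17 and Ray57 carry the
same four printed antecedents as Corner57). No summit is proved by this line; BSD is NOT proved. -/
@[route_item "route-BirchSwinnertonDyer-TwistFamilyManinDescent"]
def CornerResidualOfSupersingularTransport : Prop :=
  SupersingularCornerTwistTransport → OrdinaryCornerManinResidual → SupersingularStrongIsUnstarred → EisensteinRaynaudRegimeManinUnit → EisensteinCornerManinResidual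

-- `CornerResidualOfSupersingularTransport` holds: proved by `Summit.BirchSwinnertonDyer.BirchSwinnertonDyer.Theorems.TwistFamilyManinDescent.cornerResidualOfSupersingularTransport_proof` (its module imports this route file, so no `_holds` link can be stated here).

/-- item stmt-BirchSwinnertonDyer-27560 · aside · rank 4065 · closed · proved by Summit.BirchSwinnertonDyer.BirchSwinnertonDyer.Theorems.TwistFamilyManinDescent.ordinaryCornerOfWildDichotomy_proof (prover) · by planner
[support · glue · LINE 18 · PROVED in HOME ideas/Sketch18.lean
(`ordinaryCornerOfWildDichotomy_proof`, lean check rc 0, 0 sorries, against a verbatim local copy of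
OrdinaryCornerManinResidual)] OrdinaryCornerWildEdixhovenDichotomy (K18a) →
OrdinaryCornerUnstarredNotBottom (K18b) → OrdinaryCornerTameManinResidual (K18t) →
OrdinaryCornerManinResidual (stmt-27552). Proof: case split on (wild table row); off it K18t
verbatim; on it level = conductor (`IsNewformOf.level_eq_conductorNorm_of_exists_isNewformOf`,
`subst`), `Fact p.Prime`, p | c ⇒ (v < 6 ∧ BOTTOM χ) by K18a, the table + v < 6 leave the unstarred
rows (5;3),(7;2),(7;4), and K18b at the Legendre character (`isQuadratic_quadraticChar_ringHomComp`,
`isPrimitive_quadraticChar_ringHomComp`, p ≠ 2) contradicts BOTTOM. No free fact enters. Open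
content of the ordinary corner afterwards: K18a (new lever) + K18b (C1-shape) + declared tame
residual K18t. No summit, rung or leaf is proved by this line; BSD is NOT proved. -/
@[route_item "route-BirchSwinnertonDyer-TwistFamilyManinDescent"]
def OrdinaryCornerOfWildDichotomy : Prop :=
  OrdinaryCornerWildEdixhovenDichotomy → OrdinaryCornerUnstarredNotBottom → OrdinaryCornerTameManinResidual → OrdinaryCornerManinResidual

-- `OrdinaryCornerOfWildDichotomy` holds: proved by `Summit.BirchSwinnertonDyer.BirchSwinnertonDyer.Theorems.TwistFamilyManinDescent.ordinaryCornerOfWildDichotomy_proof` (its module imports this route file, so no `_holds` link can be stated here).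

/-- item stmt-BirchSwinnertonDyer-27663 · support · rank 4066 · closed · proved by Summit.BirchSwinnertonDyer.BirchSwinnertonDyer.Theorems.ordinaryCornerOffTable_proof (prover) · by planner
[support] [support · LINE 18R · bookkeeping, PROVABLE NOW (S/M)] OrdinaryCornerManinResidual
(stmt-27552) restricted to the rows OUTSIDE the ordinary table ((5; v ∉ {3,9}) after the Raynaud
rows {4,8} and the supersingular rows {2,10} are removed; (7; v ∉ {2,4,8,10}) after {3,9}): these
rows are EMPTY — p² | N = conductor (level = conductor from exists_isNewformOf) makes W additive at
p, additive potentially good reduction at p ≥ 5 has v_pΔ_min ∈ {2,3,4,6,8,9,10}, v = 6 is I₀* whose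
p*-twist has good reduction, and the potentially multiplicative types I_n^* twist to I_n
(multiplicative) — both excluded by the hypothesis ¬(twist good ∨ twist multiplicative). Proof
route: `Addv` from p² ∣ conductor (HOME ideas/Sketch16.lean `addv_of_sq_dvd_level`), the
Kodaira/Tate table for v_pΔ_min of additive curves at p ≥ 5 (Literature Rank1Residual/Additive:
`padicValInt_minimalDiscriminantInt` lemmas used by `padicVal_twist_identity`), and the twist-type
lemmas for I₀*/I_n^* (TeichmullerTwistDescent files). No new mathematics; filed as support so that
the LINE 18R glue is residual-free. No summit, rung or leaf is proved by this line; BSD is NOT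
proved. -/
@[route_item "route-BirchSwinnertonDyer-TwistFamilyManinDescent"]
def OrdinaryCornerOffTable : Prop :=
  Literature.NumberTheory.EllipticCurves.ModularForms.mazur_not_dvd_maninConstant_of_odd → Literature.NumberTheory.EllipticCurves.ModularForms.abbesUllmo_not_dvd_maninConstant_of_not_dvd_level → Literature.NumberTheory.EllipticCurves.ModularForms.cesnavicius_not_two_dvd_maninConstant_of_two_dvd_level → Literature.NumberTheory.EllipticCurves.ModularForms.exists_isNewformOf → ∀ (W : WeierstrassCurve ℚ) [W.IsElliptic] [W.IsGloballyMinimal] {N : ℕ} [NeZero N] (D : Literature.NumberTheory.EllipticCurves.ModularForms.ModularParametrizationData W N) (p : ℕ) (hp : p.Prime), (p = 5 ∨ p = 7) → ¬ ((p = 5 ∧ padicValInt 5 W.minimalDiscriminantInt ∈ ({4, 8} : Finset ℕ)) ∨ (p = 7 ∧ padicValInt 7 W.minimalDiscriminantInt ∈ ({3, 9} : Finset ℕ))) → ¬ (p = 5 ∧ padicValInt 5 W.minimalDiscriminantInt ∈ ({2, 10} : Finset ℕ)) → ¬ ((p = 5 ∧ padicValInt 5 W.minimalDiscriminantInt ∈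 ({3, 9} : Finset ℕ)) ∨ (p = 7 ∧ padicValInt 7 W.minimalDiscriminantInt ∈ ({2, 4, 8, 10} : Finset ℕ))) → p ^ 2 ∣ N → ¬ W.HasIrreducibleModPGaloisRep p → ¬ ((W.quadraticTwist (((-1 : ℤ) ^ (p / 2) * p : ℤ) : ℚ)).HasGoodReductionAt ((Rat.HeightOneSpectrum.primesEquiv (R := ℤ)).symm ⟨p, hp⟩) ∨ (W.quadraticTwist (((-1 : ℤ) ^ (p / 2) * p : ℤ) : ℚ)).HasMultiplicativeReductionAt ((Rat.HeightOneSpectrum.primesEquiv (R := ℤ)).symm ⟨p, hp⟩)) → (∀ z ∈ D.L.lattice, ∃ w ∈ Literature.NumberTheory.EllipticCurves.ModularForms.periodLattice D.f, z = D.c * w) → ¬ (p : ℤ) ∣ D.maninConstant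

-- `OrdinaryCornerOffTable` holds: proved by `Summit.BirchSwinnertonDyer.BirchSwinnertonDyer.Theorems.ordinaryCornerOffTable_proof` (its module imports this route file, so no `_holds` link can be stated here).

/-- item stmt-BirchSwinnertonDyer-27664 · support · rank 4067 · closed · proved by Summit.BirchSwinnertonDyer.BirchSwinnertonDyer.Theorems.TwistFamilyManinDescent.ordinaryCornerOfSerreTateDepth_proof (prover) · by planner
[support] [support · glue · LINE 18R · PROVED in HOME ideas/Sketch18R.lean
(`ordinaryCornerOfSerreTateDepth_proof`, lean check rc 0, 0 sorries, against a verbatim local copy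
of OrdinaryCornerManinResidual)] I9 (optimal ⇒ Serre–Tate-deep) → K18a″ (deep dichotomy: p | c ⇒
unstarred ∧ BOTTOM) → K18b″ (deep unstarred ⇒ ¬BOTTOM) → OffTable (vacuous rows) →
OrdinaryCornerManinResidual (stmt-27552). Proof: by_cases on the ordinary table row; off it,
OffTable verbatim; on it, DEEP from I9, level = conductor
(`IsNewformOf.level_eq_conductorNorm_of_exists_isNewformOf`, subst), p | c ⇒ (v < 6 ∧ BOTTOM χ) by
K18a″, the table + v < 6 leave rows (5;3),(7;2),(7;4), and K18b″ at the Legendre character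
(`isQuadratic_quadraticChar_ringHomComp`, `isPrimitive_quadraticChar_ringHomComp`) contradicts
BOTTOM. This REPLACES the LINE 18 split (K18a stmt-27557, K18b stmt-27558, K18t stmt-27559, G18
stmt-27560 → asked to be set `aside`: instrument I9 shows their WILD hypothesis is met by no optimal
curve, so that split put the whole corner into its declared residual). Open content of the ordinary
corner after LINE 18R: I9 (finite-model orientation law, new) + K18a″ (dévissage + Φ-specialisation)
+ K18b″ (C1- -/
@[route_item "route-BirchSwinnertonDyer-TwistFamilyManinDescent"]
def OrdinaryCornerOfSerreTateDepth : Prop :=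
  OrdinaryCornerOptimalSerreTateDeep → OrdinaryCornerDeepEdixhovenDichotomy → OrdinaryCornerDeepUnstarredNotBottom → OrdinaryCornerOffTable → OrdinaryCornerManinResidual

-- `OrdinaryCornerOfSerreTateDepth` holds: proved by `Summit.BirchSwinnertonDyer.BirchSwinnertonDyer.Theorems.TwistFamilyManinDescent.ordinaryCornerOfSerreTateDepth_proof` (its module imports this route file, so no `_holds` link can be stated here).

/-- item stmt-BirchSwinnertonDyer-27665 · support · rank 4068 · closed · proved by Summit.BirchSwinnertonDyer.BirchSwinnertonDyer.Theorems.supersingularCornerTwistTransportOfGK_proof (prover) · by planner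
[support] [support · LINE 17 · critic V85 price (1) PAID: T17 with the Gealy–Klagsbrun orientation
fact DISPLAYED; PROVABLE NOW outright (L)]
`gealyKlagsbrun2017_neronScalar_of_additive_potSupersingular`
(Literature/NumberTheory/EllipticCurves/IsogenyNeronScalarPotSupersingular.lean:77; cite-only def,
no `_holds`; GK 2017 Thm 1 at K = ℚ_p in lattice form: on an additive potentially SUPERSINGULAR
class the Néron scalar of a p-isogeny is a unit from the smaller v_pΔ_min to the larger and p from
the larger to the smaller) → SupersingularCornerTwistTransport (stmt-27551). As the critic
re-derived, the orientation m(α) = v(deg α) − 2v(n_α) = sign(Δv) is indispensable (the unoriented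
tree lemma `not_dvd_or_dvd_and_not_sq_dvd_neronScaling_of_prime` leaves (j,m) = (1,2) resp. (0,−1)
and v(c_B) = 1), and Mazur/Abbes–Ullmo/Česnavičius give nothing at 25 | N; so T17 itself is provable
MODULO GK Thm 1, and this item is the outright-provable form (house style of the displayed fact
bundles 25141/EdixhovenLargePrimeManinFacts). Proof = the T17 derivation (HOME
ideas/LINE17-ss-corner-twist-transport.md; tree: padicVal_twist_identity,
zagier_degree_formula_of_cosetReps, gaussSum_mul_mem_periodLatti -/
@[route_item "route-BirchSwinnertonDyer-TwistFamilyManinDescent"]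
def SupersingularCornerTwistTransportOfGK : Prop :=
  Literature.NumberTheory.EllipticCurves.gealyKlagsbrun2017_neronScalar_of_additive_potSupersingular → SupersingularCornerTwistTransport

-- `SupersingularCornerTwistTransportOfGK` holds: proved by `Summit.BirchSwinnertonDyer.BirchSwinnertonDyer.Theorems.supersingularCornerTwistTransportOfGK_proof` (its module imports this route file, so no `_holds` link can be stated here).

/-- item stmt-BirchSwinnertonDyer-25142 · assembly · rank 1 · closed · proved by Summit.BirchSwinnertonDyer.BirchSwinnertonDyer.Theorems.TwistFamilyManinDescent.assembly_proof (prover) · by planner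
sources: Stevens1989, Mazur1978, CremonaAlgorithms1997
[assembly] ASSEMBLY = the glue of this route's split of X₅ (PROVABLE NOW, size M): p ∣ c with p ≥ 5,
p² ∣ N: E[p] irreducible ⇒ IrreducibleAdditiveManinUnit (Addv from p² ∣ N =
`two_le_conductorExponent_iff_holds` and the level = conductor
`IsNewformOf.level_eq_conductorNorm_of_exists_isNewformOf`); reducible and W ⊗ χ_{p*} semistable at
p ⇒ tree `not_dvd_maninConstant_of_isSemistableAt_quadraticTwist_pStar`; reducible twist-minimal, p
≥ 11, p ≠ 13 ⇒ LargePrimeReducibleJ puts (p, j) in the table, the (37, ·) rows are never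
twist-minimal additive, the others are IsogenyTableFamiliesManinOne (|c| = 1 ⇒ p ∤ c,
`ClassAbsManinConstantEqOne.not_dvd_maninConstant`) except the 2⁶-corner of j(−163); what is left is
literally EisensteinAdditiveManinResidual. [difficulty: M] -/
@[route_item "route-BirchSwinnertonDyer-TwistFamilyManinDescent", crux]
def Assembly : Prop :=
  KatoIharaCremonaFacts → TwistFamilyDescent → IsogenyTableFamiliesManinOne → LargePrimeReducibleJ → IrreducibleAdditiveManinUnit → EisensteinAdditiveManinResidual → ManinPrimeToAdditiveFiveLe

-- `Assembly` holds: proved by `Summit.BirchSwinnertonDyer.BirchSwinnertonDyer.Theorems.TwistFamilyManinDescent.assembly_proof` (its module imports this route file, so no `_holds` link can be stated here).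

/-! D-0027 §2.1 — DECIDING THEOREM (planner-authored via `route open/edit --closes-file`; by planner-bsd-idea-3-g4-0 2026-08-28T03:06:33Z):
its hypotheses are this route's items and its conclusion the registered leaf `Summit.BirchSwinnertonDyer.Rank1Residual.ManinConstant.ManinConstantOne` (rung F2-MANIN, D-0061) (glue_lint), and it elaborates with this file. -/

@[closes "route-BirchSwinnertonDyer-TwistFamilyManinDescent"] theorem closes
    (hPF : PrintedSemistableManinFacts) (h2 : ManinOddAtFour) (h3 : ManinPrimeToThreeAtNine)
    (hF : KatoIharaCremonaFacts) (hT : TwistFamilyDescent) (hJ : IsogenyTableFamiliesManinOne)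
    (hL : LargePrimeReducibleJ) (hI : IrreducibleAdditiveManinUnit) (hR : EisensteinAdditiveManinResidual)
    (hA : Assembly) :
    Summit.BirchSwinnertonDyer.Rank1Residual.ManinConstant.ManinConstantOne :=
  Summit.BirchSwinnertonDyer.BirchSwinnertonDyer.Theorems.maninLocalTwoThree_assembly_proof hPF h2 h3
    (hA hF hT hJ hL hI hR)

end Summit.BirchSwinnertonDyer.BirchSwinnertonDyer.Theses.TwistFamilyManinDescent
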